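import Literature.MathematicalPhysics.QuantumFieldTheory.Balaban1983to89.Beta.HidentScalewise
import Literature.MathematicalPhysics.QuantumFieldTheory.Balaban1983to89.Beta.AveragedAFCarrier
import Literature.MathematicalPhysics.QuantumFieldTheory.Balaban1983to89.Beta.SquareTableSlotsScalewise
import Literature.MathematicalPhysics.QuantumFieldTheory.Balaban1983to89.Beta.DriftRemainder

/-!
# Beta / AveragedAFCarrierScalewise — the wall's END statement with EXACTLY the four located items as its β-binders
# (RULING (R16-1)/(R16-2): the TRIVIAL instance `μC := fun j _ => β⁰ j`), and the [III]-SIDE TWIN of an2's scale-wise form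
# `HidentScalewise` (β sub-cell, [III]-side CO-LEAD unit `b2b-balaban-strat-b14` gen 15; BETA-SPEC §5.15 (c) / §5.19 (g) / §5.20 / §7.31)
# v1.1 (same gen, APPEND-ONLY + one import): + §3 the GENERIC drift × constant-remainder socket on the [III] side, + §4 the [III] twins of an3's
# five slot END theorems (`SquareTableSlots`, `SquareTableSlotsScalewise` — the (D1-rep) table side)
# v1.2 (APPEND-ONLY + DOCFIX, statements untouched): + §5 the (D1-tel) TELESCOPE form on the [III] side; three docstrings no longer group the
# structural `ForwardGenerated` under (D5) (XREAD C-lit3g15-1 R1); generator pointer + §-reference wording (XREAD C-pv14-74 R1/R3)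
# v1.3 (gen 17, APPEND-ONLY + ONE import `Beta.DriftRemainder`): + §6 the [III] twins of an4's `DriftRemainder` v1.1 §6 (p186633): the §3/§5 drift and telescope sockets with the
# printed-type upper bound `hup`/`hβ'` DERIVED on the drift road (`betaUpperH_of_drift_remainderConst`, `upperConst_nonneg`) — β′ := b + 2A + r COMPUTED; of (D5) only (C) remains

HONEST FRAMING (page 1 of everything the β sub-cell writes): discharging `BetaPertH` makes Bałaban's UV stability UNCONDITIONAL — a
real constructive-QFT result; it is NOT the continuum limit and NOT the Clay problem.  THIS MODULE is CLASS-LEVEL BOOKKEEPING: it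
composes two LANDED kernel files — an2's `HidentScalewise` v1 (p184266; the scale-wise form of the wall's one-loop binder `hident`)
and this lineage's `AveragedAFCarrier` v1.8 (p184099; the [III]-side END theorem
`wallEND_of_composedLegInterfacePow_identity_avg_remainderConst_allProfiles`) — and asserts nothing printed by Bałaban; every statement is
[folklore] bookkeeping over the cell's hypothesis carriers.  EVERY load-bearing β-binder below is UNINSTANTIATED for Bałaban's objects;
the wall (BETA-SPEC §7.20 (T) / §7.31, `BETA/WALL.md` v1.6) is UNTOUCHED; road-(1) verdict unchanged (PRECISELY WALLED at END-STATEMENT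
grade; nothing of (M2⁺) discharged); value = census precision, NOT summit progress.

ABSOLUTE RULE (cell charter, verbatim): "No internally-minted statement may enter as a cited fact. Every hypothesis is either
kernel-proved in this package or a verbatim quotation of a PUBLISHED theorem with page reference. The manuscript(s) under audit are
NOT citable for their own disputed steps — they are the thing under adjudication; programme-internal (2001/route/tribunal) claims
are never citable."

## §1 THE CENSUS FORM OF THE WALL (RULING (R16-1)/(R16-2), BETA-SPEC §7.31; beta-ref C-beta-167 / A-R290 / A-R298)

RULING (R16-1): at END-STATEMENT grade the wall `ComposedRoad.…_identity_avg_remainderConst` is applied at the TRIVIAL instance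
`μC := fun j _ => Sβ.β0 j`, `hid := rfl` (`HidentScalewise.identityForm_trivial`); the Hessian data, the read-out `F` and `hβ` of the
final-type forms (`ComposedRoadFromSpec`, `AveragedAFCarrierFromSpec`) are FREE PARAMETERS (inhabited for every `β⁰`), never owed.
RULING (R16-2): what the wall then assumes of the one-loop physics is EXACTLY

  (D1)  `∀ m ≥ 1, ∃ R₀ ≥ M (Lc^m), |Σ_{j<m} β⁰_j − Σ_{b ∈ Bset (Lc^m)} wt_b · Σ_{w ∈ annulus 4 0 R₀} w_μ w_ν Σ_i cc₀ i · F′_b i (Lc^m) w · G′_b i (Lc^m) w| ≤ U`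

— the one-loop REPRESENTATION of the partial sums of the flow coefficients by the base-point-averaged leg bilinear of the cell's table,
up to an `m`-uniform error.  §1 states the wall ONCE in this form, BOTH SIDES, with (D1) written LITERALLY as a hypothesis on the
partial sums `∑ j ∈ range m, Sβ.β0 j` (no `μC`, no `IdentityForm`, no Hessian kernel, no read-out): its β-binders are then exactly the
census's four located items — (D1) `hD1`; (D3) the per-base-point leg binders `hF hG hFtail hGtail` (+ table `hdeg hval`, weights,
window); (D4) `RemainderConst Sβ γ₀ rr` with `rr ≤ stepBal N Lc` (endpoint existence) / `rr < stepBal N Lc` STRICTLY (the [III] list —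
`ConstRemainderConsumers.Margin.sum246_fails` at equality); (D5) `BetaContH` (+ the printed-type bound `BetaUpperH`) — and, NOT among the
located items, the STRUCTURAL `ForwardGenerated` (WALL §4) and the [III] run-side data.  Theorems: `betaAvgAFH_trivial_avg_remainderConst` (the carrier `BetaAvgAFH (stepBal N Lc − rr) (2A′) γ₀ β`, same `A′` as the
wall), `endpointExistence_trivial_avg_remainderConst` (sub-cell side: `EndpointExistence Cn`; the lead's socket — stated here for the
record, re-home at will), `wallEND_trivial_avg_remainderConst_allProfiles` ([III] side: `EndpointExistence Cn ∧ ∃ γ₁ > 0, ∀ γ ≤ min γ₀ γ₁,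
∀ runs in ]0,γ], ∀ p′ ≤ p, ∀ A₀ ≥ 0: sizes (2.28)/(2.31) ∧ HorizonFacts` — (2.6)–(2.9) + (2.46) of [Balaban1988Convergent] pp. 255–263 —
every `β₀ > 0`, below one threshold).  Each proof is ONE application of the corresponding `_identity_avg_remainderConst` theorem at
`μC := fun j _ => Sβ.β0 j` with `hid := identityForm_trivial Sβ.β0` (`composedCoeff_trivial` is `rfl`).

## §2 THE [III]-SIDE TWIN OF THE SCALE-WISE FORM (an2 `HidentScalewise` v1 p184266; RULING (R16-3))

For an2's `HidentScalewise.endpointExistence_of_scalewise_remainderConst[_of_symmetries]` (conclusion `EndpointExistence Cn`, remainder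
clause `rr ≤ stepBal N Lc`; (D1) replaced, with the SAME conclusion and constant, by the scale-wise one-loop data `T 𝒯 : ℕ → EKer 4`,
Hessian data (`AbsMoment₂` + (T0)/(T1), resp. divergence-freeness + midpoint inversion), an ADDITIVE read-out `F` with
`hβ : ∀ j, Sβ.β0 j = F (m2Tensor (T j))`, (N1-B) `HessianTelescoping Lc T 𝒯` and (I2-rep) `OneShotRepresentation Lc F 𝒯 …`) the
[III]-side twin `wallEND_of_scalewise_avg_remainderConst[_of_symmetries]_allProfiles` takes THE SAME binders with the remainder clause
STRICT plus the [III] run-side data (`HaltsOutside`, `CurriesHBeta`, `0 ≤ β′` — already there —, `0 < β₀`, `L ≥ 2`, a maximal profile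
exponent `p`, `κ₀ ≥ 6`) and concludes the [III] list as in §1; `betaAvgAFH_of_scalewise_avg_remainderConst` is the carrier (Table 9.1 of
MISSING-B14 §9: the SAME (slope, defect) pair `(stepBal N Lc − rr, 2A′)` as the (R13-3) wall).  Proofs: §1 with
`hD1 := HidentScalewise.hident_trivial_of_scalewise[_of_symmetries] …`.  NO FREE LUNCH (an2's `oneShotRep_iff_hident_of_telescoping`,
beta-ref C-beta-167): at the dipole witness the scale-wise data are inhabited for every `β⁰` and (I2-rep) IS (D1) again — the split
earns content only for the GENUINE one-step / one-shot one-loop Hessian kernels; the [III] side inherits that reading verbatim.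

READING CLAUSE (W-KKT-2): as in `HidentScalewise` / `ComposedRoadFromSpec` (headers) — `wK` is the response kernel of the solution
operator of the TYPED U = 1 block-averaging KKT system `AffineReproduction.InfiniteVolumeSpec`; its identification with Bałaban's U = 1
gauge-fixed linearised minimiser ([Balaban1984PropagatorsI] p. 26 (1.48)–(1.49); [Balaban1985BackgroundPropagators] p. 417
(3.109)–(3.110) at U = 1) and of `T j` / `𝒯 m` with the one-step / one-shot one-loop Hessian kernels of [Balaban1987RG1] p. 264
(1.20)–(1.22) is the sub-cell's READING (DICT-KKT) — NOT asserted by any theorem here.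

Source located (consumer locators, quoted verbatim in `B14FlowStep` / `AveragedAFCarrier`, nothing newly quoted): [Balaban1987RG1,
Thm 2 p.259, Thm 3 p.264]; [Balaban1988Convergent, (2.5)–(2.9) pp.255–256, (2.28) p.259, (2.46) p.263].
-/

namespace Literature.MathematicalPhysics.QuantumFieldTheory.Balaban1983to89.Beta.AveragedAFCarrierScalewise

open Finset
open Literature.Probability.LatticeModels (annulus)
open Literature.MathematicalPhysics.QuantumFieldTheory.Balaban1983to89
open FlowStep FlowStepRuns DagBinding B14DeltaBeta
open Literature.MathematicalPhysics.QuantumFieldTheory.Balaban1983to89.Beta.TransverseStructure (E4)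
open Literature.MathematicalPhysics.QuantumFieldTheory.Balaban1983to89.Beta.LeadingCoefficient (leadingIntegrand kappaBal transverseValue)
open Literature.MathematicalPhysics.QuantumFieldTheory.Balaban1983to89.Beta.DyadicShell (Pt toReal supNorm)
open Literature.MathematicalPhysics.QuantumFieldTheory.Balaban1983to89.Beta.BubbleTransfer (Leg contBubble bubbleConst)
open Literature.MathematicalPhysics.QuantumFieldTheory.Balaban1983to89.Beta.Drift (OneLoopDrift)
open Literature.MathematicalPhysics.QuantumFieldTheory.Balaban1983to89.Beta.RemainderChain (RemainderConst)
open Literature.MathematicalPhysics.QuantumFieldTheory.Balaban1983to89.Beta.MarginalTelescoping (composedCoeff IdentityForm)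
open Literature.MathematicalPhysics.QuantumFieldTheory.Balaban1983to89.Beta.LargeLWindow.WindowDecomposition (constA)
open DecimatedMomentSummable (AbsMoment₂)
open DressedMomentNormalisation (EKer coarseTensor m2Tensor)
open HidentScalewise (Tensor4 HessianTelescoping OneShotRepresentation composedCoeff_trivial identityForm_trivial
  hident_trivial_of_scalewise hident_trivial_of_scalewise_of_symmetries)
open ComposedRoad AveragedAFCarrier

variable {ι : Type*} {s : Finset ι} {cc₀ : ι → ℝ} {P Q : ι → Leg} {κB : Type*}

/-! ## §1 The census form: (D1) literal, (D3), (D4), (D5) — both sides -/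

section CensusForm

variable {β : HBeta}

/-- **THE CENSUS FORM ⟹ THE CARRIER.**  The §10 averaged leg binders of `ComposedRoad.oneLoopDrift_of_composedLegInterfacePow_identity_avg`
verbatim — table (W1)₀ `hdeg hval`, base points and convex weights `hwt0 hwt1`, window `hM hML`, per-base-point window data `hF hG` and
tails `hFtail hGtail` (= (D3)) — plus (D1) LITERALLY on the partial sums (`hD1`) and (D4) `RemainderConst Sβ γ₀ rr` give
`BetaAvgAFH (stepBal N Lc − rr) (2A′) γ₀ β` with `A′` the wall's window constant.  No `μC`, no `IdentityForm`, no Hessian kernel, no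
read-out among the binders (RULING (R16-1): those were never load-bearing). [folklore] -/
theorem betaAvgAFH_trivial_avg_remainderConst (Sβ : B12Beta.OneLoopSplit β)
    (hdeg : ∀ i ∈ s, (P i).a + (Q i).a = 6) {μ ν : Fin 4} (hμν : μ ≠ ν) {N : ℝ} (hN : N ≠ 0)
    (hval : ∀ x : E4, x ≠ 0 → x μ * x ν * contBubble s cc₀ P Q x = leadingIntegrand (kappaBal N) μ ν x)
    {Lc : ℕ} (hL : 2 ≤ Lc)
    {F' G' : κB → ι → ℕ → Pt → ℝ} {R Sg R' S' : ι → ℝ} {δ U cc : ℝ} {M : ℕ → ℕ}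
    {Bset : ℕ → Finset κB} {wt : ℕ → κB → ℝ}
    (hwt0 : ∀ n : ℕ, 2 ≤ n → ∀ b ∈ Bset n, 0 ≤ wt n b) (hwt1 : ∀ n : ℕ, 2 ≤ n → ∑ b ∈ Bset n, wt n b = 1)
    (hR : ∀ i ∈ s, 0 ≤ R i) (hS : ∀ i ∈ s, 0 ≤ Sg i) (hR' : ∀ i ∈ s, 0 ≤ R' i) (hS' : ∀ i ∈ s, 0 ≤ S' i) (hδ : 0 < δ)
    (hc : 1 ≤ cc) (hM : ∀ L : ℕ, 2 ≤ L → 1 ≤ M L ∧ (L : ℝ) ≤ cc * M L) (hML : ∀ L : ℕ, 2 ≤ L → M L ≤ L)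
    (hF : ∀ m : ℕ, 1 ≤ m → ∀ b ∈ Bset (Lc ^ m), ∀ w ∈ annulus 4 0 (M (Lc ^ m)), ∀ i ∈ s,
      |F' b i (Lc ^ m) w - (P i).f (Lc ^ m) 0 w| ≤ R i / ((supNorm w : ℝ) ^ ((P i).a - 2) * ((Lc ^ m : ℕ) : ℝ) ^ 2))
    (hG : ∀ m : ℕ, 1 ≤ m → ∀ b ∈ Bset (Lc ^ m), ∀ w ∈ annulus 4 0 (M (Lc ^ m)), ∀ i ∈ s,
      |G' b i (Lc ^ m) w - (Q i).f (Lc ^ m) 0 w| ≤ Sg i / ((supNorm w : ℝ) ^ ((Q i).a - 2) * ((Lc ^ m : ℕ) : ℝ) ^ 2))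
    (hFtail : ∀ m : ℕ, 1 ≤ m → ∀ b ∈ Bset (Lc ^ m), ∀ r : ℕ, M (Lc ^ m) ≤ r → ∀ w ∈ annulus 4 r (r + 1), ∀ i ∈ s,
      |F' b i (Lc ^ m) w| ≤ R' i / ((r : ℝ) + 1) ^ (P i).a * Real.exp (-(δ / ((Lc ^ m : ℕ) : ℝ)) * ((r : ℝ) + 1)))
    (hGtail : ∀ m : ℕ, 1 ≤ m → ∀ b ∈ Bset (Lc ^ m), ∀ r : ℕ, M (Lc ^ m) ≤ r → ∀ w ∈ annulus 4 r (r + 1), ∀ i ∈ s,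
      |G' b i (Lc ^ m) w| ≤ S' i / ((r : ℝ) + 1) ^ (Q i).a)
    -- (D1), LITERALLY: the partial sums of the flow coefficients are represented by the averaged leg bilinear, error `U` uniform in `m`
    (hD1 : ∀ m : ℕ, 1 ≤ m → ∃ R₀ : ℕ, M (Lc ^ m) ≤ R₀ ∧
      |∑ j ∈ range m, Sβ.β0 j - ∑ b ∈ Bset (Lc ^ m), wt (Lc ^ m) b * ∑ w ∈ annulus 4 0 R₀, toReal w μ * toReal w ν *
        ∑ i ∈ s, cc₀ i * (F' b i (Lc ^ m) w * G' b i (Lc ^ m) w)| ≤ U)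
    {rr γ₀ : ℝ} (hrem : RemainderConst Sβ γ₀ rr) :
    BetaAvgAFH (B12Normalization.stepBal N Lc - rr)
      (2 * constA (|kappaBal N| * 24 + |kappaBal N| * 110592) (bubbleConst s cc₀ P Q)
          ((80 * (∑ i ∈ s, |cc₀ i| * (R' i * S' i)) * (1 + cc / δ) + U) +
            80 * ∑ i ∈ s, |cc₀ i| * ((((P i).A + (P i).B) * Sg i + R i * ((Q i).A + (Q i).B) + R i * Sg i)))
          cc (kappaBal N * transverseValue)) γ₀ β :=
  betaAvgAFH_of_composedLegInterfacePow_identity_avg_remainderConst (μC := fun j _ => Sβ.β0 j) Sβ hdeg hμν hN hval hL hwt0 hwt1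
    hR hS hR' hS' hδ hc hM hML hF hG hFtail hGtail
    (fun m hm => by simpa only [composedCoeff_trivial] using hD1 m hm) (identityForm_trivial Sβ.β0) hrem

/-- **THE CENSUS FORM OF THE WALL, SUB-CELL SIDE** (RULING (R16-1)/(R16-2); the lead's §10 `_avg` wall
`ComposedRoad.endpointExistence_of_composedLegInterfacePow_identity_avg_remainderConst` at `μC := fun j _ => Sβ.β0 j`, `hid := rfl`):
`EndpointExistence Cn` from EXACTLY (D1) `hD1` (literal, on the partial sums), (D3) the per-base-point leg binders (+ table, weights,
window), (D4) `RemainderConst Sβ γ₀ rr` with `rr ≤ stepBal N Lc`, (D5) `BetaContH` + `BetaUpperH β′` (`β′ ≥ 0`); plus the STRUCTURAL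
`ForwardGenerated` (WALL §4 — not a located item; v1.2 docfix, XREAD C-lit3g15-1 R1).  Stated on the [III] side for the record; the socket is the lead's (`Beta/ComposedRoad` §10). [folklore] -/
theorem endpointExistence_trivial_avg_remainderConst {Cn : B12.Construction}
    (hgen : ForwardGenerated Cn β) (Sβ : B12Beta.OneLoopSplit β)
    (hdeg : ∀ i ∈ s, (P i).a + (Q i).a = 6) {μ ν : Fin 4} (hμν : μ ≠ ν) {N : ℝ} (hN : N ≠ 0)
    (hval : ∀ x : E4, x ≠ 0 → x μ * x ν * contBubble s cc₀ P Q x = leadingIntegrand (kappaBal N) μ ν x)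
    {Lc : ℕ} (hL : 2 ≤ Lc)
    {F' G' : κB → ι → ℕ → Pt → ℝ} {R Sg R' S' : ι → ℝ} {δ U cc : ℝ} {M : ℕ → ℕ}
    {Bset : ℕ → Finset κB} {wt : ℕ → κB → ℝ}
    (hwt0 : ∀ n : ℕ, 2 ≤ n → ∀ b ∈ Bset n, 0 ≤ wt n b) (hwt1 : ∀ n : ℕ, 2 ≤ n → ∑ b ∈ Bset n, wt n b = 1)
    (hR : ∀ i ∈ s, 0 ≤ R i) (hS : ∀ i ∈ s, 0 ≤ Sg i) (hR' : ∀ i ∈ s, 0 ≤ R' i) (hS' : ∀ i ∈ s, 0 ≤ S' i) (hδ : 0 < δ)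
    (hc : 1 ≤ cc) (hM : ∀ L : ℕ, 2 ≤ L → 1 ≤ M L ∧ (L : ℝ) ≤ cc * M L) (hML : ∀ L : ℕ, 2 ≤ L → M L ≤ L)
    (hF : ∀ m : ℕ, 1 ≤ m → ∀ b ∈ Bset (Lc ^ m), ∀ w ∈ annulus 4 0 (M (Lc ^ m)), ∀ i ∈ s,
      |F' b i (Lc ^ m) w - (P i).f (Lc ^ m) 0 w| ≤ R i / ((supNorm w : ℝ) ^ ((P i).a - 2) * ((Lc ^ m : ℕ) : ℝ) ^ 2))
    (hG : ∀ m : ℕ, 1 ≤ m → ∀ b ∈ Bset (Lc ^ m), ∀ w ∈ annulus 4 0 (M (Lc ^ m)), ∀ i ∈ s,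
      |G' b i (Lc ^ m) w - (Q i).f (Lc ^ m) 0 w| ≤ Sg i / ((supNorm w : ℝ) ^ ((Q i).a - 2) * ((Lc ^ m : ℕ) : ℝ) ^ 2))
    (hFtail : ∀ m : ℕ, 1 ≤ m → ∀ b ∈ Bset (Lc ^ m), ∀ r : ℕ, M (Lc ^ m) ≤ r → ∀ w ∈ annulus 4 r (r + 1), ∀ i ∈ s,
      |F' b i (Lc ^ m) w| ≤ R' i / ((r : ℝ) + 1) ^ (P i).a * Real.exp (-(δ / ((Lc ^ m : ℕ) : ℝ)) * ((r : ℝ) + 1)))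
    (hGtail : ∀ m : ℕ, 1 ≤ m → ∀ b ∈ Bset (Lc ^ m), ∀ r : ℕ, M (Lc ^ m) ≤ r → ∀ w ∈ annulus 4 r (r + 1), ∀ i ∈ s,
      |G' b i (Lc ^ m) w| ≤ S' i / ((r : ℝ) + 1) ^ (Q i).a)
    (hD1 : ∀ m : ℕ, 1 ≤ m → ∃ R₀ : ℕ, M (Lc ^ m) ≤ R₀ ∧
      |∑ j ∈ range m, Sβ.β0 j - ∑ b ∈ Bset (Lc ^ m), wt (Lc ^ m) b * ∑ w ∈ annulus 4 0 R₀, toReal w μ * toReal w ν *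
        ∑ i ∈ s, cc₀ i * (F' b i (Lc ^ m) w * G' b i (Lc ^ m) w)| ≤ U)
    {rr γ₀ β' : ℝ} (hγ₀ : 0 < γ₀) (hrem : RemainderConst Sβ γ₀ rr) (hr : rr ≤ B12Normalization.stepBal N Lc)
    (hβ' : 0 ≤ β') (hcont : BetaContH γ₀ β) (hup : BetaUpperH β' γ₀ β) : EndpointExistence Cn :=
  endpointExistence_of_composedLegInterfacePow_identity_avg_remainderConst (μC := fun j _ => Sβ.β0 j) hgen Sβ hdeg hμν hN hval hL
    hwt0 hwt1 hR hS hR' hS' hδ hc hM hML hF hG hFtail hGtail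
    (fun m hm => by simpa only [composedCoeff_trivial] using hD1 m hm) (identityForm_trivial Sβ.β0)
    hγ₀ hrem hr hβ' hcont hup

/-- **THE CENSUS FORM OF THE WALL, [III] SIDE, ALL PROFILES** (RULING (R16-1)/(R16-2)).  β-binders EXACTLY: (D1) `hD1` (literal, on the
partial sums `∑ j ∈ range m, Sβ.β0 j`), (D3) the per-base-point leg binders `hF hG hFtail hGtail` (+ table `hdeg hval`, weights
`hwt0 hwt1`, window `hM hML`), (D4) `RemainderConst Sβ γ₀ rr` with `rr < stepBal N Lc` STRICTLY, (D5) `BetaContH γ₀ β` + the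
printed-type upper bound `BetaUpperH β′ γ₀ β` (`β′ ≥ 0`); plus the STRUCTURAL `ForwardGenerated` (WALL §4) and the [III] run-side data
(`HaltsOutside`, `CurriesHBeta`, `0 < β₀`, `L ≥ 2`, maximal exponent `p`, `κ₀ ≥ 6`) ⟹ `EndpointExistence Cn` ∧ `∃ γ₁ > 0`, along every run in `]0,γ]`,
`γ ≤ min γ₀ γ₁`, for every `p′ ≤ p` and `A₀ ≥ 0`: sizes ∧ `HorizonFacts` ((2.6)–(2.9) + (2.46)).  This is
`AveragedAFCarrier.wallEND_of_composedLegInterfacePow_identity_avg_remainderConst_allProfiles` at `μC := fun j _ => Sβ.β0 j`, `hid := rfl`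
— the END statement whose one-loop content is (D1) and nothing else.  EVERY β-binder uninstantiated for Bałaban's objects.
[cite: Balaban1987RG1, Thm 2 p.259 and Thm 3 p.264] [cite: Balaban1988Convergent, (2.5)–(2.9) pp.255–256, (2.28) p.259, (2.46) p.263] -/
theorem wallEND_trivial_avg_remainderConst_allProfiles {Cn : B12.Construction}
    (hgen : ForwardGenerated Cn β) (hhalt : HaltsOutside Cn β) (hcur : CurriesHBeta Cn β) (Sβ : B12Beta.OneLoopSplit β)
    (hdeg : ∀ i ∈ s, (P i).a + (Q i).a = 6) {μ ν : Fin 4} (hμν : μ ≠ ν) {N : ℝ} (hN : N ≠ 0)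
    (hval : ∀ x : E4, x ≠ 0 → x μ * x ν * contBubble s cc₀ P Q x = leadingIntegrand (kappaBal N) μ ν x)
    {Lc : ℕ} (hL : 2 ≤ Lc)
    {F' G' : κB → ι → ℕ → Pt → ℝ} {R Sg R' S' : ι → ℝ} {δ U cc : ℝ} {M : ℕ → ℕ}
    {Bset : ℕ → Finset κB} {wt : ℕ → κB → ℝ}
    (hwt0 : ∀ n : ℕ, 2 ≤ n → ∀ b ∈ Bset n, 0 ≤ wt n b) (hwt1 : ∀ n : ℕ, 2 ≤ n → ∑ b ∈ Bset n, wt n b = 1)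
    (hR : ∀ i ∈ s, 0 ≤ R i) (hS : ∀ i ∈ s, 0 ≤ Sg i) (hR' : ∀ i ∈ s, 0 ≤ R' i) (hS' : ∀ i ∈ s, 0 ≤ S' i) (hδ : 0 < δ)
    (hc : 1 ≤ cc) (hM : ∀ L : ℕ, 2 ≤ L → 1 ≤ M L ∧ (L : ℝ) ≤ cc * M L) (hML : ∀ L : ℕ, 2 ≤ L → M L ≤ L)
    (hF : ∀ m : ℕ, 1 ≤ m → ∀ b ∈ Bset (Lc ^ m), ∀ w ∈ annulus 4 0 (M (Lc ^ m)), ∀ i ∈ s,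
      |F' b i (Lc ^ m) w - (P i).f (Lc ^ m) 0 w| ≤ R i / ((supNorm w : ℝ) ^ ((P i).a - 2) * ((Lc ^ m : ℕ) : ℝ) ^ 2))
    (hG : ∀ m : ℕ, 1 ≤ m → ∀ b ∈ Bset (Lc ^ m), ∀ w ∈ annulus 4 0 (M (Lc ^ m)), ∀ i ∈ s,
      |G' b i (Lc ^ m) w - (Q i).f (Lc ^ m) 0 w| ≤ Sg i / ((supNorm w : ℝ) ^ ((Q i).a - 2) * ((Lc ^ m : ℕ) : ℝ) ^ 2))
    (hFtail : ∀ m : ℕ, 1 ≤ m → ∀ b ∈ Bset (Lc ^ m), ∀ r : ℕ, M (Lc ^ m) ≤ r → ∀ w ∈ annulus 4 r (r + 1), ∀ i ∈ s,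
      |F' b i (Lc ^ m) w| ≤ R' i / ((r : ℝ) + 1) ^ (P i).a * Real.exp (-(δ / ((Lc ^ m : ℕ) : ℝ)) * ((r : ℝ) + 1)))
    (hGtail : ∀ m : ℕ, 1 ≤ m → ∀ b ∈ Bset (Lc ^ m), ∀ r : ℕ, M (Lc ^ m) ≤ r → ∀ w ∈ annulus 4 r (r + 1), ∀ i ∈ s,
      |G' b i (Lc ^ m) w| ≤ S' i / ((r : ℝ) + 1) ^ (Q i).a)
    (hD1 : ∀ m : ℕ, 1 ≤ m → ∃ R₀ : ℕ, M (Lc ^ m) ≤ R₀ ∧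
      |∑ j ∈ range m, Sβ.β0 j - ∑ b ∈ Bset (Lc ^ m), wt (Lc ^ m) b * ∑ w ∈ annulus 4 0 R₀, toReal w μ * toReal w ν *
        ∑ i ∈ s, cc₀ i * (F' b i (Lc ^ m) w * G' b i (Lc ^ m) w)| ≤ U)
    {rr γ₀ β' β₀ : ℝ} (hγ₀ : 0 < γ₀) (hrem : RemainderConst Sβ γ₀ rr) (hr : rr < B12Normalization.stepBal N Lc)
    (hcont : BetaContH γ₀ β) (hup : BetaUpperH β' γ₀ β) (hβ' : 0 ≤ β') (hβ₀ : 0 < β₀)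
    {L : ℕ} (hL2 : 2 ≤ L) (p : ℕ) {κ₀ : ℕ} (hκ : 6 ≤ κ₀) :
    EndpointExistence Cn ∧ ∃ γ₁ : ℝ, 0 < γ₁ ∧
      ∀ γ : ℝ, 0 < γ → γ ≤ min γ₀ γ₁ → ∀ Pr : B12.RunParams, (Cn Pr).flow.InInterval γ Pr.K →
        ∀ p' : ℕ, p' ≤ p → ∀ A₀ : ℝ, 0 ≤ A₀ →
          ∃ Rj : ℕ → ℕ, (∀ j, B14.IsRj L p' ((Cn Pr).flow.g j) (Rj j)) ∧
            HorizonFacts (Cn Pr).flow β' β₀ A₀ L p' κ₀ Rj Pr.K :=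
  wallEND_of_composedLegInterfacePow_identity_avg_remainderConst_allProfiles (μC := fun j _ => Sβ.β0 j) hgen hhalt hcur Sβ hdeg hμν
    hN hval hL hwt0 hwt1 hR hS hR' hS' hδ hc hM hML hF hG hFtail hGtail
    (fun m hm => by simpa only [composedCoeff_trivial] using hD1 m hm) (identityForm_trivial Sβ.β0)
    hγ₀ hrem hr hcont hup hβ' hβ₀ hL2 p hκ

end CensusForm

/-! ## §2 The [III]-side twin of an2's scale-wise form (`HidentScalewise` v1) -/

section Scalewise

variable {β : HBeta}

/-- **THE SCALE-WISE FORM ⟹ THE CARRIER.**  The binders of an2's `HidentScalewise.oneLoopDrift_of_scalewise` verbatim (table, the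
scale-wise one-loop data `T 𝒯`, Hessian data `hTA hT0 hT1`, additive read-out `F`, `hβ`, (N1-B) `HessianTelescoping`, the §10 averaged
leg binders, (I2-rep) `OneShotRepresentation`) + (D4) `RemainderConst Sβ γ₀ rr` ⟹ `BetaAvgAFH (stepBal N Lc − rr) (2A′) γ₀ β` — the SAME
(slope, defect) pair as the (R13-3) wall (MISSING-B14 §9 Table 9.1).  Proof: §1 with `hD1 := hident_trivial_of_scalewise …`. [folklore] -/
theorem betaAvgAFH_of_scalewise_avg_remainderConst (Sβ : B12Beta.OneLoopSplit β)
    (hdeg : ∀ i ∈ s, (P i).a + (Q i).a = 6) {μ ν : Fin 4} (hμν : μ ≠ ν) {N : ℝ} (hN : N ≠ 0)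
    (hval : ∀ x : E4, x ≠ 0 → x μ * x ν * contBubble s cc₀ P Q x = leadingIntegrand (kappaBal N) μ ν x)
    {Lc : ℕ} [NeZero Lc] (hL : 2 ≤ Lc)
    -- the scale-wise one-loop data (an2 `HidentScalewise`)
    (T 𝒯 : ℕ → EKer 4) (hTA : ∀ j c e, AbsMoment₂ (T j c e)) (hT0 : ∀ j c e, HasSum (T j c e) 0)
    (hT1 : ∀ j c e (ρ : Fin 4), HasSum (fun t : Fin 4 → ℤ => t ρ • T j c e t) 0)
    (F : Tensor4 → ℝ) (hFadd : ∀ A B, F (A + B) = F A + F B) (hβ : ∀ j, Sβ.β0 j = F (m2Tensor (T j)))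
    (htel : HessianTelescoping Lc T 𝒯)
    -- the leg-level binders of `ComposedRoad` §10, verbatim
    {F' G' : κB → ι → ℕ → Pt → ℝ} {R Sg R' S' : ι → ℝ} {δ U cc : ℝ} {M : ℕ → ℕ}
    {Bset : ℕ → Finset κB} {wt : ℕ → κB → ℝ}
    (hwt0 : ∀ n : ℕ, 2 ≤ n → ∀ b ∈ Bset n, 0 ≤ wt n b) (hwt1 : ∀ n : ℕ, 2 ≤ n → ∑ b ∈ Bset n, wt n b = 1)
    (hR : ∀ i ∈ s, 0 ≤ R i) (hS : ∀ i ∈ s, 0 ≤ Sg i) (hR' : ∀ i ∈ s, 0 ≤ R' i) (hS' : ∀ i ∈ s, 0 ≤ S' i) (hδ : 0 < δ)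
    (hc : 1 ≤ cc) (hM : ∀ L : ℕ, 2 ≤ L → 1 ≤ M L ∧ (L : ℝ) ≤ cc * M L) (hML : ∀ L : ℕ, 2 ≤ L → M L ≤ L)
    (hF : ∀ m : ℕ, 1 ≤ m → ∀ b ∈ Bset (Lc ^ m), ∀ w' ∈ annulus 4 0 (M (Lc ^ m)), ∀ i ∈ s,
      |F' b i (Lc ^ m) w' - (P i).f (Lc ^ m) 0 w'| ≤ R i / ((supNorm w' : ℝ) ^ ((P i).a - 2) * ((Lc ^ m : ℕ) : ℝ) ^ 2))
    (hG : ∀ m : ℕ, 1 ≤ m → ∀ b ∈ Bset (Lc ^ m), ∀ w' ∈ annulus 4 0 (M (Lc ^ m)), ∀ i ∈ s,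
      |G' b i (Lc ^ m) w' - (Q i).f (Lc ^ m) 0 w'| ≤ Sg i / ((supNorm w' : ℝ) ^ ((Q i).a - 2) * ((Lc ^ m : ℕ) : ℝ) ^ 2))
    (hFtail : ∀ m : ℕ, 1 ≤ m → ∀ b ∈ Bset (Lc ^ m), ∀ r : ℕ, M (Lc ^ m) ≤ r → ∀ w' ∈ annulus 4 r (r + 1), ∀ i ∈ s,
      |F' b i (Lc ^ m) w'| ≤ R' i / ((r : ℝ) + 1) ^ (P i).a * Real.exp (-(δ / ((Lc ^ m : ℕ) : ℝ)) * ((r : ℝ) + 1)))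
    (hGtail : ∀ m : ℕ, 1 ≤ m → ∀ b ∈ Bset (Lc ^ m), ∀ r : ℕ, M (Lc ^ m) ≤ r → ∀ w' ∈ annulus 4 r (r + 1), ∀ i ∈ s,
      |G' b i (Lc ^ m) w'| ≤ S' i / ((r : ℝ) + 1) ^ (Q i).a)
    -- (I2-rep): ONE comparison per scale
    (hrep : OneShotRepresentation Lc F 𝒯 s cc₀ μ ν Bset wt F' G' M U)
    {rr γ₀ : ℝ} (hrem : RemainderConst Sβ γ₀ rr) :
    BetaAvgAFH (B12Normalization.stepBal N Lc - rr)
      (2 * constA (|kappaBal N| * 24 + |kappaBal N| * 110592) (bubbleConst s cc₀ P Q)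
          ((80 * (∑ i ∈ s, |cc₀ i| * (R' i * S' i)) * (1 + cc / δ) + U) +
            80 * ∑ i ∈ s, |cc₀ i| * ((((P i).A + (P i).B) * Sg i + R i * ((Q i).A + (Q i).B) + R i * Sg i)))
          cc (kappaBal N * transverseValue)) γ₀ β :=
  betaAvgAFH_of_composedLegInterfacePow_identity_avg_remainderConst (μC := fun j _ => Sβ.β0 j) Sβ hdeg hμν hN hval hL hwt0 hwt1
    hR hS hR' hS' hδ hc hM hML hF hG hFtail hGtail
    (hident_trivial_of_scalewise hTA hT0 hT1 htel hFadd hβ hrep) (identityForm_trivial Sβ.β0) hrem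

/-- **THE SCALE-WISE FORM, [III] SIDE, ALL PROFILES.**  The binders of an2's
`HidentScalewise.endpointExistence_of_scalewise_remainderConst` verbatim — table, scale-wise one-loop data `T 𝒯`, Hessian data
`hTA hT0 hT1`, additive read-out `F`, `hβ`, (N1-B) `HessianTelescoping`, the §10 averaged leg binders, (I2-rep) `OneShotRepresentation`,
`RemainderConst`, (C), printed-type upper bound — with the remainder clause STRICT (`rr < stepBal N Lc`) and the [III] run-side data ⟹
`EndpointExistence Cn` ∧ the located [III] list for all profile exponents `p′ ≤ p` and amplitudes `A₀ ≥ 0`, every `β₀ > 0`, below one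
threshold.  Proof: §1's `wallEND_trivial_avg_remainderConst_allProfiles` with `hD1 := hident_trivial_of_scalewise …`.  Subject to the
READING CLAUSE of the header; NO FREE LUNCH (`HidentScalewise.oneShotRep_iff_hident_of_telescoping`).
[cite: Balaban1987RG1, Thm 2 p.259 and Thm 3 p.264] [cite: Balaban1988Convergent, (2.5)–(2.9) pp.255–256, (2.28) p.259, (2.46) p.263] -/
theorem wallEND_of_scalewise_avg_remainderConst_allProfiles {Cn : B12.Construction}
    (hgen : ForwardGenerated Cn β) (hhalt : HaltsOutside Cn β) (hcur : CurriesHBeta Cn β) (Sβ : B12Beta.OneLoopSplit β)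
    (hdeg : ∀ i ∈ s, (P i).a + (Q i).a = 6) {μ ν : Fin 4} (hμν : μ ≠ ν) {N : ℝ} (hN : N ≠ 0)
    (hval : ∀ x : E4, x ≠ 0 → x μ * x ν * contBubble s cc₀ P Q x = leadingIntegrand (kappaBal N) μ ν x)
    {Lc : ℕ} [NeZero Lc] (hL : 2 ≤ Lc)
    (T 𝒯 : ℕ → EKer 4) (hTA : ∀ j c e, AbsMoment₂ (T j c e)) (hT0 : ∀ j c e, HasSum (T j c e) 0)
    (hT1 : ∀ j c e (ρ : Fin 4), HasSum (fun t : Fin 4 → ℤ => t ρ • T j c e t) 0)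
    (F : Tensor4 → ℝ) (hFadd : ∀ A B, F (A + B) = F A + F B) (hβ : ∀ j, Sβ.β0 j = F (m2Tensor (T j)))
    (htel : HessianTelescoping Lc T 𝒯)
    {F' G' : κB → ι → ℕ → Pt → ℝ} {R Sg R' S' : ι → ℝ} {δ U cc : ℝ} {M : ℕ → ℕ}
    {Bset : ℕ → Finset κB} {wt : ℕ → κB → ℝ}
    (hwt0 : ∀ n : ℕ, 2 ≤ n → ∀ b ∈ Bset n, 0 ≤ wt n b) (hwt1 : ∀ n : ℕ, 2 ≤ n → ∑ b ∈ Bset n, wt n b = 1)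
    (hR : ∀ i ∈ s, 0 ≤ R i) (hS : ∀ i ∈ s, 0 ≤ Sg i) (hR' : ∀ i ∈ s, 0 ≤ R' i) (hS' : ∀ i ∈ s, 0 ≤ S' i) (hδ : 0 < δ)
    (hc : 1 ≤ cc) (hM : ∀ L : ℕ, 2 ≤ L → 1 ≤ M L ∧ (L : ℝ) ≤ cc * M L) (hML : ∀ L : ℕ, 2 ≤ L → M L ≤ L)
    (hF : ∀ m : ℕ, 1 ≤ m → ∀ b ∈ Bset (Lc ^ m), ∀ w' ∈ annulus 4 0 (M (Lc ^ m)), ∀ i ∈ s,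
      |F' b i (Lc ^ m) w' - (P i).f (Lc ^ m) 0 w'| ≤ R i / ((supNorm w' : ℝ) ^ ((P i).a - 2) * ((Lc ^ m : ℕ) : ℝ) ^ 2))
    (hG : ∀ m : ℕ, 1 ≤ m → ∀ b ∈ Bset (Lc ^ m), ∀ w' ∈ annulus 4 0 (M (Lc ^ m)), ∀ i ∈ s,
      |G' b i (Lc ^ m) w' - (Q i).f (Lc ^ m) 0 w'| ≤ Sg i / ((supNorm w' : ℝ) ^ ((Q i).a - 2) * ((Lc ^ m : ℕ) : ℝ) ^ 2))
    (hFtail : ∀ m : ℕ, 1 ≤ m → ∀ b ∈ Bset (Lc ^ m), ∀ r : ℕ, M (Lc ^ m) ≤ r → ∀ w' ∈ annulus 4 r (r + 1), ∀ i ∈ s,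
      |F' b i (Lc ^ m) w'| ≤ R' i / ((r : ℝ) + 1) ^ (P i).a * Real.exp (-(δ / ((Lc ^ m : ℕ) : ℝ)) * ((r : ℝ) + 1)))
    (hGtail : ∀ m : ℕ, 1 ≤ m → ∀ b ∈ Bset (Lc ^ m), ∀ r : ℕ, M (Lc ^ m) ≤ r → ∀ w' ∈ annulus 4 r (r + 1), ∀ i ∈ s,
      |G' b i (Lc ^ m) w'| ≤ S' i / ((r : ℝ) + 1) ^ (Q i).a)
    (hrep : OneShotRepresentation Lc F 𝒯 s cc₀ μ ν Bset wt F' G' M U)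
    {rr γ₀ β' β₀ : ℝ} (hγ₀ : 0 < γ₀) (hrem : RemainderConst Sβ γ₀ rr) (hr : rr < B12Normalization.stepBal N Lc)
    (hcont : BetaContH γ₀ β) (hup : BetaUpperH β' γ₀ β) (hβ' : 0 ≤ β') (hβ₀ : 0 < β₀)
    {L : ℕ} (hL2 : 2 ≤ L) (p : ℕ) {κ₀ : ℕ} (hκ : 6 ≤ κ₀) :
    EndpointExistence Cn ∧ ∃ γ₁ : ℝ, 0 < γ₁ ∧
      ∀ γ : ℝ, 0 < γ → γ ≤ min γ₀ γ₁ → ∀ Pr : B12.RunParams, (Cn Pr).flow.InInterval γ Pr.K →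
        ∀ p' : ℕ, p' ≤ p → ∀ A₀ : ℝ, 0 ≤ A₀ →
          ∃ Rj : ℕ → ℕ, (∀ j, B14.IsRj L p' ((Cn Pr).flow.g j) (Rj j)) ∧
            HorizonFacts (Cn Pr).flow β' β₀ A₀ L p' κ₀ Rj Pr.K :=
  wallEND_of_composedLegInterfacePow_identity_avg_remainderConst_allProfiles (μC := fun j _ => Sβ.β0 j) hgen hhalt hcur Sβ hdeg hμν
    hN hval hL hwt0 hwt1 hR hS hR' hS' hδ hc hM hML hF hG hFtail hGtail
    (hident_trivial_of_scalewise hTA hT0 hT1 htel hFadd hβ hrep) (identityForm_trivial Sβ.β0)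
    hγ₀ hrem hr hcont hup hβ' hβ₀ hL2 p hκ

/-- **… with (T0)/(T1) from the two symmetries of the Hessian kernels** (divergence-freeness `hdiv` + midpoint inversion `hinv`; an2's
`HidentScalewise.endpointExistence_of_scalewise_remainderConst_of_symmetries`), [III] side, all profiles.
[cite: Balaban1988Convergent, (2.5)–(2.9) pp.255–256 and (2.46) p.263] -/
theorem wallEND_of_scalewise_avg_remainderConst_of_symmetries_allProfiles {Cn : B12.Construction}
    (hgen : ForwardGenerated Cn β) (hhalt : HaltsOutside Cn β) (hcur : CurriesHBeta Cn β) (Sβ : B12Beta.OneLoopSplit β)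
    (hdeg : ∀ i ∈ s, (P i).a + (Q i).a = 6) {μ ν : Fin 4} (hμν : μ ≠ ν) {N : ℝ} (hN : N ≠ 0)
    (hval : ∀ x : E4, x ≠ 0 → x μ * x ν * contBubble s cc₀ P Q x = leadingIntegrand (kappaBal N) μ ν x)
    {Lc : ℕ} [NeZero Lc] (hL : 2 ≤ Lc)
    (T 𝒯 : ℕ → EKer 4) (hTA : ∀ j c e, AbsMoment₂ (T j c e))
    (hdiv : ∀ j (ν' : Fin 4) (x : Fin 4 → ℤ), ∑ μ', (T j μ' ν' x - T j μ' ν' (x - Pi.single μ' 1)) = 0)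
    (hinv : ∀ j (μ' ν' : Fin 4) (y : Fin 4 → ℤ), T j μ' ν' ((Pi.single ν' 1 - Pi.single μ' 1) - y) = T j μ' ν' y)
    (F : Tensor4 → ℝ) (hFadd : ∀ A B, F (A + B) = F A + F B) (hβ : ∀ j, Sβ.β0 j = F (m2Tensor (T j)))
    (htel : HessianTelescoping Lc T 𝒯)
    {F' G' : κB → ι → ℕ → Pt → ℝ} {R Sg R' S' : ι → ℝ} {δ U cc : ℝ} {M : ℕ → ℕ}
    {Bset : ℕ → Finset κB} {wt : ℕ → κB → ℝ}
    (hwt0 : ∀ n : ℕ, 2 ≤ n → ∀ b ∈ Bset n, 0 ≤ wt n b) (hwt1 : ∀ n : ℕ, 2 ≤ n → ∑ b ∈ Bset n, wt n b = 1)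
    (hR : ∀ i ∈ s, 0 ≤ R i) (hS : ∀ i ∈ s, 0 ≤ Sg i) (hR' : ∀ i ∈ s, 0 ≤ R' i) (hS' : ∀ i ∈ s, 0 ≤ S' i) (hδ : 0 < δ)
    (hc : 1 ≤ cc) (hM : ∀ L : ℕ, 2 ≤ L → 1 ≤ M L ∧ (L : ℝ) ≤ cc * M L) (hML : ∀ L : ℕ, 2 ≤ L → M L ≤ L)
    (hF : ∀ m : ℕ, 1 ≤ m → ∀ b ∈ Bset (Lc ^ m), ∀ w' ∈ annulus 4 0 (M (Lc ^ m)), ∀ i ∈ s,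
      |F' b i (Lc ^ m) w' - (P i).f (Lc ^ m) 0 w'| ≤ R i / ((supNorm w' : ℝ) ^ ((P i).a - 2) * ((Lc ^ m : ℕ) : ℝ) ^ 2))
    (hG : ∀ m : ℕ, 1 ≤ m → ∀ b ∈ Bset (Lc ^ m), ∀ w' ∈ annulus 4 0 (M (Lc ^ m)), ∀ i ∈ s,
      |G' b i (Lc ^ m) w' - (Q i).f (Lc ^ m) 0 w'| ≤ Sg i / ((supNorm w' : ℝ) ^ ((Q i).a - 2) * ((Lc ^ m : ℕ) : ℝ) ^ 2))
    (hFtail : ∀ m : ℕ, 1 ≤ m → ∀ b ∈ Bset (Lc ^ m), ∀ r : ℕ, M (Lc ^ m) ≤ r → ∀ w' ∈ annulus 4 r (r + 1), ∀ i ∈ s,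
      |F' b i (Lc ^ m) w'| ≤ R' i / ((r : ℝ) + 1) ^ (P i).a * Real.exp (-(δ / ((Lc ^ m : ℕ) : ℝ)) * ((r : ℝ) + 1)))
    (hGtail : ∀ m : ℕ, 1 ≤ m → ∀ b ∈ Bset (Lc ^ m), ∀ r : ℕ, M (Lc ^ m) ≤ r → ∀ w' ∈ annulus 4 r (r + 1), ∀ i ∈ s,
      |G' b i (Lc ^ m) w'| ≤ S' i / ((r : ℝ) + 1) ^ (Q i).a)
    (hrep : OneShotRepresentation Lc F 𝒯 s cc₀ μ ν Bset wt F' G' M U)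
    {rr γ₀ β' β₀ : ℝ} (hγ₀ : 0 < γ₀) (hrem : RemainderConst Sβ γ₀ rr) (hr : rr < B12Normalization.stepBal N Lc)
    (hcont : BetaContH γ₀ β) (hup : BetaUpperH β' γ₀ β) (hβ' : 0 ≤ β') (hβ₀ : 0 < β₀)
    {L : ℕ} (hL2 : 2 ≤ L) (p : ℕ) {κ₀ : ℕ} (hκ : 6 ≤ κ₀) :
    EndpointExistence Cn ∧ ∃ γ₁ : ℝ, 0 < γ₁ ∧
      ∀ γ : ℝ, 0 < γ → γ ≤ min γ₀ γ₁ → ∀ Pr : B12.RunParams, (Cn Pr).flow.InInterval γ Pr.K →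
        ∀ p' : ℕ, p' ≤ p → ∀ A₀ : ℝ, 0 ≤ A₀ →
          ∃ Rj : ℕ → ℕ, (∀ j, B14.IsRj L p' ((Cn Pr).flow.g j) (Rj j)) ∧
            HorizonFacts (Cn Pr).flow β' β₀ A₀ L p' κ₀ Rj Pr.K :=
  wallEND_of_composedLegInterfacePow_identity_avg_remainderConst_allProfiles (μC := fun j _ => Sβ.β0 j) hgen hhalt hcur Sβ hdeg hμν
    hN hval hL hwt0 hwt1 hR hS hR' hS' hδ hc hM hML hF hG hFtail hGtail
    (hident_trivial_of_scalewise_of_symmetries hTA hdiv hinv htel hFadd hβ hrep) (identityForm_trivial Sβ.β0)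
    hγ₀ hrem hr hcont hup hβ' hβ₀ hL2 p hκ

end Scalewise

/-! ## §3 (v1.1) THE GENERIC DRIFT × CONSTANT-REMAINDER SOCKET ON THE [III] SIDE

Every drift-level road-(1) END theorem in the tree is ONE application of the lead's/an4's `DriftRemainder.endpointExistence_of_drift_remainderConst`
(`OneLoopDrift b A S.β0` + `RemainderConst S γ₀ r` + `r ≤ b` + (U) + (C) ⟹ `EndpointExistence`) to the road's drift theorem.  §3 is that socket's
[III]-side twin — so the [III] twin of ANY such END theorem is the same one application with the road's drift theorem (§4 does it by name for an3's
slot forms; `AveragedAFCarrierVectorTails` §1 did it for the average-first scalar wall).  Nothing new mathematically: `AveragedAFCarrier`'s §2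
`betaAvgAFH_of_driftRemainderConst` + its §11/§12 (XREAD C-pv14-74 R1/R3 wording, v1.2). -/

section DriftSocket

variable {β : HBeta}

/-- **THE DRIFT × CONSTANT-REMAINDER SOCKET, [III] SIDE, ALL PROFILES** — twin of `DriftRemainder.endpointExistence_of_drift_remainderConst`:
`OneLoopDrift b A S.β0` (BINDER: the wall's one-loop content in drift form), `RemainderConst S γ₀ r` ((D4)) with `r < b` STRICTLY, (C), the
printed-type upper bound `β′ ≥ 0`, and the [III] run-side data ⟹ `EndpointExistence C ∧ ∃ γ₁ > 0, ∀ γ ≤ min γ₀ γ₁, ∀ runs in ]0,γ], ∀ p′ ≤ p,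
∀ A₀ ≥ 0: sizes ∧ HorizonFacts` ((2.6)–(2.9) + (2.46)), every `β₀ > 0` — carrier `(b − r, 2A)`.
[cite: Balaban1987RG1, Thm 2 p.259 and Thm 3 p.264] [cite: Balaban1988Convergent, (2.5)–(2.9) pp.255–256, (2.28) p.259, (2.46) p.263] -/
theorem wallEND_of_drift_remainderConst_allProfiles {C : B12.Construction} (hgen : ForwardGenerated C β) (hhalt : HaltsOutside C β)
    (hcur : CurriesHBeta C β) (S : B12Beta.OneLoopSplit β) {γ₀ b A r β' β₀ : ℝ} (hγ₀ : 0 < γ₀) (hdrift : OneLoopDrift b A S.β0)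
    (hrem : RemainderConst S γ₀ r) (hr : r < b) (hcont : BetaContH γ₀ β) (hup : BetaUpperH β' γ₀ β) (hβ' : 0 ≤ β')
    (hβ₀ : 0 < β₀) {L : ℕ} (hL2 : 2 ≤ L) (p : ℕ) {κ₀ : ℕ} (hκ : 6 ≤ κ₀) :
    EndpointExistence C ∧ ∃ γ₁ : ℝ, 0 < γ₁ ∧
      ∀ γ : ℝ, 0 < γ → γ ≤ min γ₀ γ₁ → ∀ Pr : B12.RunParams, (C Pr).flow.InInterval γ Pr.K →
        ∀ p' : ℕ, p' ≤ p → ∀ A₀ : ℝ, 0 ≤ A₀ →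
          ∃ Rj : ℕ → ℕ, (∀ j, B14.IsRj L p' ((C Pr).flow.g j) (Rj j)) ∧
            HorizonFacts (C Pr).flow β' β₀ A₀ L p' κ₀ Rj Pr.K :=
  (betaAvgAFH_of_driftRemainderConst S hdrift hrem).endpoint_and_flowControl_allProfiles (sub_pos.mpr hr) hgen hhalt hcur hγ₀ hβ' hβ₀
    hL2 p hcont hup hκ

/-- **… AT SLOPE ≥ 0: (2.6)–(2.9) FOR ALL PROFILES, WITHOUT (2.46)** (`r ≤ b`; NO continuity) — twin of the same socket at the bare END grade.
[cite: Balaban1988Convergent, (2.5)–(2.9) pp.255–256] -/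
theorem flowIneq_of_drift_remainderConst_allProfiles {C : B12.Construction} (hgen : ForwardGenerated C β) (hhalt : HaltsOutside C β)
    (hcur : CurriesHBeta C β) (S : B12Beta.OneLoopSplit β) {γ₀ b A r β' β₀ : ℝ} (hγ₀ : 0 < γ₀) (hdrift : OneLoopDrift b A S.β0)
    (hrem : RemainderConst S γ₀ r) (hr : r ≤ b) (hup : BetaUpperH β' γ₀ β) (hβ' : 0 ≤ β') (hβ₀ : 0 < β₀) {L : ℕ} (hL2 : 2 ≤ L)
    (p : ℕ) :
    ∃ γ₁ : ℝ, 0 < γ₁ ∧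
      ∀ γ : ℝ, 0 < γ → γ ≤ min γ₀ γ₁ → ∀ Pr : B12.RunParams, (C Pr).flow.InInterval γ Pr.K →
        ∀ p' : ℕ, p' ≤ p → ∀ A₀ : ℝ, 0 ≤ A₀ →
          ∃ Rj : ℕ → ℕ, (∀ j, B14.IsRj L p' ((C Pr).flow.g j) (Rj j)) ∧
            B14.FlowIneq26 (C Pr).flow.g β' β₀ Pr.K ∧ B14.FlowIneq27 (C Pr).flow.g β' β₀ p' Pr.K ∧
            B14.FlowIneq28 (epsK A₀ p' (C Pr).flow) (C Pr).flow.g β' β₀ Pr.K ∧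
            B14FlowStep.FlowIneq29 Rj (C Pr).flow.g L β' β₀ Pr.K :=
  (betaAvgAFH_of_driftRemainderConst S hdrift hrem).flowIneq_allProfiles (sub_nonneg.mpr hr) hgen hhalt hcur hγ₀ hβ' hβ₀ hL2 p hup

/-- **… AT SLOPE ≥ 0: THE T⁴ CELL's FLOW-FACT BINDERS** (census C19/C20; `r ≤ b`; NO continuity). [cite: Balaban1988Convergent, (2.5)–(2.9) pp.255–256] -/
theorem t4FlowInputs_of_drift_remainderConst {C : B12.Construction} (hgen : ForwardGenerated C β) (hhalt : HaltsOutside C β)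
    (hcur : CurriesHBeta C β) (S : B12Beta.OneLoopSplit β) {γ₀ b A r β' β₀ : ℝ} (hγ₀ : 0 < γ₀) (hdrift : OneLoopDrift b A S.β0)
    (hrem : RemainderConst S γ₀ r) (hr : r ≤ b) (hup : BetaUpperH β' γ₀ β) (hβ' : 0 ≤ β') (hβ₀ : 0 < β₀) {L : ℕ} (hL2 : 2 ≤ L)
    {p₀ r' : ℕ} (hr' : r' ≤ p₀) :
    ∃ γ₁ : ℝ, 0 < γ₁ ∧ ∀ γ : ℝ, 0 < γ → γ ≤ min γ₀ γ₁ → ∀ Pr : B12.RunParams, (C Pr).flow.InInterval γ Pr.K →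
      B14.FlowIneq27 (C Pr).flow.g β' β₀ p₀ Pr.K ∧
      (∀ j, j ≤ Pr.K → 1 ≤ Real.log (((C Pr).flow.g j) ^ 2)⁻¹) ∧
      ∃ Rj : ℕ → ℕ, (∀ j, B14.IsRj L r' ((C Pr).flow.g j) (Rj j)) ∧ B14FlowStep.FlowIneq29 Rj (C Pr).flow.g L β' β₀ Pr.K :=
  (betaAvgAFH_of_driftRemainderConst S hdrift hrem).t4FlowInputs_of_nonneg (sub_nonneg.mpr hr) hgen hhalt hcur hγ₀ hβ' hβ₀ hL2 hr' hup

end DriftSocket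

/-! ## §4 (v1.1) an3's SLOT forms on the [III] side (`SquareTableSlots` p184314, `SquareTableSlotsScalewise` p184408 — the (D1-rep) table side)

Binder blocks COPIED FROM THE TREE (generator staged as `HOME/b2b-balaban-strat-b14/g15/make_scalewise_v11.py`) with exactly the [III] deltas (`(hhalt)(hcur)` after `hgen`; `{rr γ₀ β' β₀}`;
`hr : rr < stepBal N Lc` STRICT; `hβ'` behind `hup`; tail `(hβ₀){L}(hL2)(p){κ₀}(hκ)`); proof terms = an3's own with the END socket swapped (§3's
drift socket for the two slot-bounds forms; §2's scale-wise twins for the three scale-wise forms). -/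

section Slots

open Literature.MathematicalPhysics.QuantumFieldTheory.Balaban1983to89.Beta.SquareTable
open Literature.MathematicalPhysics.QuantumFieldTheory.Balaban1983to89.Beta.SquareTableSlots
open Literature.MathematicalPhysics.QuantumFieldTheory.Balaban1983to89.Beta.SquareTableSlotsScalewise
open Literature.MathematicalPhysics.QuantumFieldTheory.Balaban1983to89.Beta.GhostTable (gFree)
open Literature.MathematicalPhysics.QuantumFieldTheory.Balaban1983to89.Beta.BubbleTransfer (unitVec)
open Literature.MathematicalPhysics.QuantumFieldTheory.Balaban1983to89.Beta.WindowIdentification (fullSum)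

variable {μ ν : Fin 4} {K : Type*} [Fintype K]

/-- [III] twin of an3's `SquareTableSlots.endpointExistence_of_slotBounds` (slot families, one base point; §3's socket on `oneLoopDrift_of_slotBounds`).
[cite: Balaban1988Convergent, (2.5)–(2.9) pp.255–256 and (2.46) p.263] -/
theorem wallEND_of_slotBounds_allProfiles {β : HBeta} {Cn : B12.Construction} (hgen : ForwardGenerated Cn β)
    (hhalt : HaltsOutside Cn β) (hcur : CurriesHBeta Cn β)
    (S : B12Beta.OneLoopSplit β) (hμν : μ ≠ ν) {N : ℝ} (hN : N ≠ 0)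
    {Lc : ℕ} (hL : 2 ≤ Lc) {μC : ℕ → ℕ → ℝ} {ω : BfIdx → K → ℝ} (hω : ∀ i, ∑ κ, ω i κ = 1)
    {GP GQ : ℕ → BfIdx × K → Pt → ℝ} {D A : ℕ → ℝ} (hD : ∀ j, 0 ≤ D j) (hA : ∀ j, 0 ≤ A j)
    {δ U cc : ℝ} {M : ℕ → ℕ} (hδ : 0 < δ)
    (hc : 1 ≤ cc) (hM : ∀ L : ℕ, 2 ≤ L → 1 ≤ M L ∧ (L : ℝ) ≤ cc * M L) (hML : ∀ L : ℕ, 2 ≤ L → M L ≤ L)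
    (hWP : ∀ n : ℕ, 2 ≤ n → ∀ p, WindowRows μ ν D n (GP n p))
    (hWQ : ∀ n : ℕ, 2 ≤ n → ∀ p, WindowRows μ ν D n (GQ n p))
    (hDP : ∀ n : ℕ, 2 ≤ n → ∀ p, DecayRows μ ν A δ n (GP n p))
    (hDQ : ∀ n : ℕ, 2 ≤ n → ∀ p, DecayRows μ ν A δ n (GQ n p))
    (hU : ∀ m : ℕ, 1 ≤ m → |composedCoeff μC m - fullSum (stKc μ ν N ω (GP (Lc ^ m)) (GQ (Lc ^ m)))| ≤ U)
    (hid : IdentityForm μC S.β0)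
    {rr γ₀ β' β₀ : ℝ} (hγ₀ : 0 < γ₀) (hrem : RemainderConst S γ₀ rr) (hr : rr < B12Normalization.stepBal N Lc)
    (hcont : BetaContH γ₀ β) (hup : BetaUpperH β' γ₀ β) (hβ' : 0 ≤ β') (hβ₀ : 0 < β₀)
    {L : ℕ} (hL2 : 2 ≤ L) (p : ℕ) {κ₀ : ℕ} (hκ : 6 ≤ κ₀) :
    EndpointExistence Cn ∧ ∃ γ₁ : ℝ, 0 < γ₁ ∧
      ∀ γ : ℝ, 0 < γ → γ ≤ min γ₀ γ₁ → ∀ Pr : B12.RunParams, (Cn Pr).flow.InInterval γ Pr.K →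
        ∀ p' : ℕ, p' ≤ p → ∀ A₀ : ℝ, 0 ≤ A₀ →
          ∃ Rj : ℕ → ℕ, (∀ j, B14.IsRj L p' ((Cn Pr).flow.g j) (Rj j)) ∧
            HorizonFacts (Cn Pr).flow β' β₀ A₀ L p' κ₀ Rj Pr.K :=
  wallEND_of_drift_remainderConst_allProfiles hgen hhalt hcur S hγ₀
    (oneLoopDrift_of_slotBounds S hμν hN hL hω hD hA hδ hc hM hML hWP hWQ hDP hDQ hU hid) hrem hr hcont hup hβ' hβ₀ hL2 p hκ

/-- [III] twin of an3's `SquareTableSlots.endpointExistence_of_slotBounds_avg` (base-point-averaged slot families; §3's socket on `oneLoopDrift_of_slotBounds_avg`).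
[cite: Balaban1988Convergent, (2.5)–(2.9) pp.255–256 and (2.46) p.263] -/
theorem wallEND_of_slotBounds_avg_allProfiles {β : HBeta} {Cn : B12.Construction} (hgen : ForwardGenerated Cn β)
    (hhalt : HaltsOutside Cn β) (hcur : CurriesHBeta Cn β)
    (S : B12Beta.OneLoopSplit β) (hμν : μ ≠ ν) {N : ℝ} (hN : N ≠ 0)
    {Lc : ℕ} (hL : 2 ≤ Lc) {μC : ℕ → ℕ → ℝ} {ω : BfIdx → K → ℝ} (hω : ∀ i, ∑ κ, ω i κ = 1)
    {Bset : ℕ → Finset κB} {wt : ℕ → κB → ℝ} {GP GQ : ℕ → κB → BfIdx × K → Pt → ℝ} {D A : ℕ → ℝ}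
    (hD : ∀ j, 0 ≤ D j) (hA : ∀ j, 0 ≤ A j) {δ U cc : ℝ} {M : ℕ → ℕ} (hδ : 0 < δ)
    (hwt0 : ∀ n : ℕ, 2 ≤ n → ∀ b ∈ Bset n, 0 ≤ wt n b) (hwt1 : ∀ n : ℕ, 2 ≤ n → ∑ b ∈ Bset n, wt n b = 1)
    (hc : 1 ≤ cc) (hM : ∀ L : ℕ, 2 ≤ L → 1 ≤ M L ∧ (L : ℝ) ≤ cc * M L) (hML : ∀ L : ℕ, 2 ≤ L → M L ≤ L)
    (hWP : ∀ n : ℕ, 2 ≤ n → ∀ b ∈ Bset n, ∀ p, WindowRows μ ν D n (GP n b p))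
    (hWQ : ∀ n : ℕ, 2 ≤ n → ∀ b ∈ Bset n, ∀ p, WindowRows μ ν D n (GQ n b p))
    (hDP : ∀ n : ℕ, 2 ≤ n → ∀ b ∈ Bset n, ∀ p, DecayRows μ ν A δ n (GP n b p))
    (hDQ : ∀ n : ℕ, 2 ≤ n → ∀ b ∈ Bset n, ∀ p, DecayRows μ ν A δ n (GQ n b p))
    (hU : ∀ m : ℕ, 1 ≤ m →
      |composedCoeff μC m - ∑ b ∈ Bset (Lc ^ m), wt (Lc ^ m) b * fullSum (stKc μ ν N ω (GP (Lc ^ m) b) (GQ (Lc ^ m) b))| ≤ U)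
    (hid : IdentityForm μC S.β0)
    {rr γ₀ β' β₀ : ℝ} (hγ₀ : 0 < γ₀) (hrem : RemainderConst S γ₀ rr) (hr : rr < B12Normalization.stepBal N Lc)
    (hcont : BetaContH γ₀ β) (hup : BetaUpperH β' γ₀ β) (hβ' : 0 ≤ β') (hβ₀ : 0 < β₀)
    {L : ℕ} (hL2 : 2 ≤ L) (p : ℕ) {κ₀ : ℕ} (hκ : 6 ≤ κ₀) :
    EndpointExistence Cn ∧ ∃ γ₁ : ℝ, 0 < γ₁ ∧
      ∀ γ : ℝ, 0 < γ → γ ≤ min γ₀ γ₁ → ∀ Pr : B12.RunParams, (Cn Pr).flow.InInterval γ Pr.K →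
        ∀ p' : ℕ, p' ≤ p → ∀ A₀ : ℝ, 0 ≤ A₀ →
          ∃ Rj : ℕ → ℕ, (∀ j, B14.IsRj L p' ((Cn Pr).flow.g j) (Rj j)) ∧
            HorizonFacts (Cn Pr).flow β' β₀ A₀ L p' κ₀ Rj Pr.K :=
  wallEND_of_drift_remainderConst_allProfiles hgen hhalt hcur S hγ₀
    (oneLoopDrift_of_slotBounds_avg S hμν hN hL hω hD hA hδ hwt0 hwt1 hc hM hML hWP hWQ hDP hDQ hU hid) hrem hr hcont hup hβ' hβ₀ hL2 p hκ

/-- [III] twin of an3's `SquareTableSlotsScalewise.endpointExistence_of_slotRows_scalewise_remainderConst` — the (D1-rep) table side JOINED to an2's scale-wise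
form: slot rows + `OneShotRepresentation` ⟹ the [III] list (§2's `wallEND_of_scalewise_avg_remainderConst_allProfiles` with an3's suppliers).
[cite: Balaban1988Convergent, (2.5)–(2.9) pp.255–256 and (2.46) p.263] -/
theorem wallEND_of_slotRows_scalewise_allProfiles {β : HBeta} {Cn : B12.Construction} (hgen : ForwardGenerated Cn β)
    (hhalt : HaltsOutside Cn β) (hcur : CurriesHBeta Cn β)
    (Sβ : B12Beta.OneLoopSplit β) (hμν : μ ≠ ν) {N : ℝ} (hN : N ≠ 0)
    {Lc : ℕ} [NeZero Lc] (hL : 2 ≤ Lc) {ω : BfIdx → K → ℝ} (hω : ∀ i, ∑ κ, ω i κ = 1)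
    (T 𝒯 : ℕ → EKer 4) (hTA : ∀ j c e, AbsMoment₂ (T j c e)) (hT0 : ∀ j c e, HasSum (T j c e) 0)
    (hT1 : ∀ j c e (ρ : Fin 4), HasSum (fun t : Fin 4 → ℤ => t ρ • T j c e t) 0)
    (F : Tensor4 → ℝ) (hFadd : ∀ A B, F (A + B) = F A + F B) (hβ : ∀ j, Sβ.β0 j = F (m2Tensor (T j)))
    (htel : HessianTelescoping Lc T 𝒯)
    {Bset : ℕ → Finset κB} {wt : ℕ → κB → ℝ} {GP GQ : ℕ → κB → BfIdx × K → Pt → ℝ} {D A : ℕ → ℝ}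
    (hD : ∀ j, 0 ≤ D j) (hA : ∀ j, 0 ≤ A j) {δ U cc : ℝ} {M : ℕ → ℕ} (hδ : 0 < δ)
    (hwt0 : ∀ n : ℕ, 2 ≤ n → ∀ b ∈ Bset n, 0 ≤ wt n b) (hwt1 : ∀ n : ℕ, 2 ≤ n → ∑ b ∈ Bset n, wt n b = 1)
    (hc : 1 ≤ cc) (hM : ∀ L : ℕ, 2 ≤ L → 1 ≤ M L ∧ (L : ℝ) ≤ cc * M L) (hML : ∀ L : ℕ, 2 ≤ L → M L ≤ L)
    (hWP : ∀ n : ℕ, 2 ≤ n → ∀ b ∈ Bset n, ∀ p, WindowRows μ ν D n (GP n b p))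
    (hWQ : ∀ n : ℕ, 2 ≤ n → ∀ b ∈ Bset n, ∀ p, WindowRows μ ν D n (GQ n b p))
    (hDP : ∀ n : ℕ, 2 ≤ n → ∀ b ∈ Bset n, ∀ p, DecayRows μ ν A δ n (GP n b p))
    (hDQ : ∀ n : ℕ, 2 ≤ n → ∀ b ∈ Bset n, ∀ p, DecayRows μ ν A δ n (GQ n b p))
    (hrep : OneShotRepresentation Lc F 𝒯 (Finset.univ : Finset (BfIdx × K)) (cpCoeff N ω) μ ν Bset wt
      (fun b p n w => stP μ ν (GP n b p) p.1 w) (fun b p n w => stQ μ ν (GQ n b p) p.1 w) M U)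
    {rr γ₀ β' β₀ : ℝ} (hγ₀ : 0 < γ₀) (hrem : RemainderConst Sβ γ₀ rr) (hr : rr < B12Normalization.stepBal N Lc)
    (hcont : BetaContH γ₀ β) (hup : BetaUpperH β' γ₀ β) (hβ' : 0 ≤ β') (hβ₀ : 0 < β₀)
    {L : ℕ} (hL2 : 2 ≤ L) (p : ℕ) {κ₀ : ℕ} (hκ : 6 ≤ κ₀) :
    EndpointExistence Cn ∧ ∃ γ₁ : ℝ, 0 < γ₁ ∧
      ∀ γ : ℝ, 0 < γ → γ ≤ min γ₀ γ₁ → ∀ Pr : B12.RunParams, (Cn Pr).flow.InInterval γ Pr.K →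
        ∀ p' : ℕ, p' ≤ p → ∀ A₀ : ℝ, 0 ≤ A₀ →
          ∃ Rj : ℕ → ℕ, (∀ j, B14.IsRj L p' ((Cn Pr).flow.g j) (Rj j)) ∧
            HorizonFacts (Cn Pr).flow β' β₀ A₀ L p' κ₀ Rj Pr.K :=
  have hR' : ∀ p ∈ (Finset.univ : Finset (BfIdx × K)), 0 ≤ A ((bfP hμν p.1).a - 2) := fun p _ => hA _
  have hS' : ∀ p ∈ (Finset.univ : Finset (BfIdx × K)), 0 ≤ A ((bfQ hμν p.1).a - 2) * 2 ^ (bfQ hμν p.1).a :=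
    fun p _ => mul_nonneg (hA _) (by positivity)
  wallEND_of_scalewise_avg_remainderConst_allProfiles hgen hhalt hcur Sβ (hdeg_cp hμν) hμν hN (hval_cp hμν N hω) hL T 𝒯 hTA hT0 hT1 F hFadd hβ htel
    hwt0 hwt1 (fun _ _ => hD _) (fun _ _ => hD _) hR' hS' hδ hc hM hML (hF_slots_avg hμν hL hML hD hWP) (hG_slots_avg hμν hL hML hD hWQ)
    (hFtail_slots_avg hμν hA hDP hL)
    (hGtail_slots_avg hμν hA hδ (fun L hL2 => (hM L hL2).1) hDQ hL) hrep hγ₀ hrem hr hcont hup hβ' hβ₀ hL2 p hκ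

/-- … with (T0)/(T1) from the two symmetries of the Hessian kernels. [cite: Balaban1988Convergent, (2.5)–(2.9) pp.255–256 and (2.46) p.263] -/
theorem wallEND_of_slotRows_scalewise_of_symmetries_allProfiles {β : HBeta} {Cn : B12.Construction}
    (hgen : ForwardGenerated Cn β) (hhalt : HaltsOutside Cn β) (hcur : CurriesHBeta Cn β)
    (Sβ : B12Beta.OneLoopSplit β) (hμν : μ ≠ ν) {N : ℝ} (hN : N ≠ 0)
    {Lc : ℕ} [NeZero Lc] (hL : 2 ≤ Lc) {ω : BfIdx → K → ℝ} (hω : ∀ i, ∑ κ, ω i κ = 1)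
    (T 𝒯 : ℕ → EKer 4) (hTA : ∀ j c e, AbsMoment₂ (T j c e))
    (hdiv : ∀ j (ν' : Fin 4) (x : Fin 4 → ℤ), ∑ μ', (T j μ' ν' x - T j μ' ν' (x - Pi.single μ' 1)) = 0)
    (hinv : ∀ j (μ' ν' : Fin 4) (y : Fin 4 → ℤ), T j μ' ν' ((Pi.single ν' 1 - Pi.single μ' 1) - y) = T j μ' ν' y)
    (F : Tensor4 → ℝ) (hFadd : ∀ A B, F (A + B) = F A + F B) (hβ : ∀ j, Sβ.β0 j = F (m2Tensor (T j)))
    (htel : HessianTelescoping Lc T 𝒯)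
    {Bset : ℕ → Finset κB} {wt : ℕ → κB → ℝ} {GP GQ : ℕ → κB → BfIdx × K → Pt → ℝ} {D A : ℕ → ℝ}
    (hD : ∀ j, 0 ≤ D j) (hA : ∀ j, 0 ≤ A j) {δ U cc : ℝ} {M : ℕ → ℕ} (hδ : 0 < δ)
    (hwt0 : ∀ n : ℕ, 2 ≤ n → ∀ b ∈ Bset n, 0 ≤ wt n b) (hwt1 : ∀ n : ℕ, 2 ≤ n → ∑ b ∈ Bset n, wt n b = 1)
    (hc : 1 ≤ cc) (hM : ∀ L : ℕ, 2 ≤ L → 1 ≤ M L ∧ (L : ℝ) ≤ cc * M L) (hML : ∀ L : ℕ, 2 ≤ L → M L ≤ L)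
    (hWP : ∀ n : ℕ, 2 ≤ n → ∀ b ∈ Bset n, ∀ p, WindowRows μ ν D n (GP n b p))
    (hWQ : ∀ n : ℕ, 2 ≤ n → ∀ b ∈ Bset n, ∀ p, WindowRows μ ν D n (GQ n b p))
    (hDP : ∀ n : ℕ, 2 ≤ n → ∀ b ∈ Bset n, ∀ p, DecayRows μ ν A δ n (GP n b p))
    (hDQ : ∀ n : ℕ, 2 ≤ n → ∀ b ∈ Bset n, ∀ p, DecayRows μ ν A δ n (GQ n b p))
    (hrep : OneShotRepresentation Lc F 𝒯 (Finset.univ : Finset (BfIdx × K)) (cpCoeff N ω) μ ν Bset wt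
      (fun b p n w => stP μ ν (GP n b p) p.1 w) (fun b p n w => stQ μ ν (GQ n b p) p.1 w) M U)
    {rr γ₀ β' β₀ : ℝ} (hγ₀ : 0 < γ₀) (hrem : RemainderConst Sβ γ₀ rr) (hr : rr < B12Normalization.stepBal N Lc)
    (hcont : BetaContH γ₀ β) (hup : BetaUpperH β' γ₀ β) (hβ' : 0 ≤ β') (hβ₀ : 0 < β₀)
    {L : ℕ} (hL2 : 2 ≤ L) (p : ℕ) {κ₀ : ℕ} (hκ : 6 ≤ κ₀) :
    EndpointExistence Cn ∧ ∃ γ₁ : ℝ, 0 < γ₁ ∧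
      ∀ γ : ℝ, 0 < γ → γ ≤ min γ₀ γ₁ → ∀ Pr : B12.RunParams, (Cn Pr).flow.InInterval γ Pr.K →
        ∀ p' : ℕ, p' ≤ p → ∀ A₀ : ℝ, 0 ≤ A₀ →
          ∃ Rj : ℕ → ℕ, (∀ j, B14.IsRj L p' ((Cn Pr).flow.g j) (Rj j)) ∧
            HorizonFacts (Cn Pr).flow β' β₀ A₀ L p' κ₀ Rj Pr.K :=
  have hR' : ∀ p ∈ (Finset.univ : Finset (BfIdx × K)), 0 ≤ A ((bfP hμν p.1).a - 2) := fun p _ => hA _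
  have hS' : ∀ p ∈ (Finset.univ : Finset (BfIdx × K)), 0 ≤ A ((bfQ hμν p.1).a - 2) * 2 ^ (bfQ hμν p.1).a :=
    fun p _ => mul_nonneg (hA _) (by positivity)
  wallEND_of_scalewise_avg_remainderConst_of_symmetries_allProfiles hgen hhalt hcur Sβ (hdeg_cp hμν) hμν hN (hval_cp hμν N hω) hL T 𝒯 hTA hdiv hinv
    F hFadd hβ htel hwt0 hwt1 (fun _ _ => hD _) (fun _ _ => hD _) hR' hS' hδ hc hM hML (hF_slots_avg hμν hL hML hD hWP)
    (hG_slots_avg hμν hL hML hD hWQ) (hFtail_slots_avg hμν hA hDP hL)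
    (hGtail_slots_avg hμν hA hδ (fun L hL2 => (hM L hL2).1) hDQ hL)
    hrep hγ₀ hrem hr hcont hup hβ' hβ₀ hL2 p hκ

/-- [III] twin of an3's `SquareTableSlotsScalewise.endpointExistence_of_slotFullSum_scalewise_remainderConst` — ONE slot full-sum comparison per scale
`|F (m2Tensor (𝒯 m)) − Σ_b wt_b·fullSum (stKc …)| ≤ U` instead of `OneShotRepresentation` (an3's `oneShotRepresentation_of_slotFullSum`).
[cite: Balaban1987RG1, Thm 2 p.259 and Thm 3 p.264] [cite: Balaban1988Convergent, (2.5)–(2.9) pp.255–256, (2.28) p.259, (2.46) p.263] -/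
theorem wallEND_of_slotFullSum_scalewise_allProfiles {β : HBeta} {Cn : B12.Construction}
    (hgen : ForwardGenerated Cn β) (hhalt : HaltsOutside Cn β) (hcur : CurriesHBeta Cn β)
    (Sβ : B12Beta.OneLoopSplit β) (hμν : μ ≠ ν) {N : ℝ} (hN : N ≠ 0)
    {Lc : ℕ} [NeZero Lc] (hL : 2 ≤ Lc) {ω : BfIdx → K → ℝ} (hω : ∀ i, ∑ κ, ω i κ = 1)
    (T 𝒯 : ℕ → EKer 4) (hTA : ∀ j c e, AbsMoment₂ (T j c e)) (hT0 : ∀ j c e, HasSum (T j c e) 0)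
    (hT1 : ∀ j c e (ρ : Fin 4), HasSum (fun t : Fin 4 → ℤ => t ρ • T j c e t) 0)
    (F : Tensor4 → ℝ) (hFadd : ∀ A B, F (A + B) = F A + F B) (hβ : ∀ j, Sβ.β0 j = F (m2Tensor (T j)))
    (htel : HessianTelescoping Lc T 𝒯)
    {Bset : ℕ → Finset κB} {wt : ℕ → κB → ℝ} {GP GQ : ℕ → κB → BfIdx × K → Pt → ℝ} {D A : ℕ → ℝ}
    (hD : ∀ j, 0 ≤ D j) (hA : ∀ j, 0 ≤ A j) {δ U cc : ℝ} {M : ℕ → ℕ} (hδ : 0 < δ)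
    (hwt0 : ∀ n : ℕ, 2 ≤ n → ∀ b ∈ Bset n, 0 ≤ wt n b) (hwt1 : ∀ n : ℕ, 2 ≤ n → ∑ b ∈ Bset n, wt n b = 1)
    (hc : 1 ≤ cc) (hM : ∀ L : ℕ, 2 ≤ L → 1 ≤ M L ∧ (L : ℝ) ≤ cc * M L) (hML : ∀ L : ℕ, 2 ≤ L → M L ≤ L)
    (hWP : ∀ n : ℕ, 2 ≤ n → ∀ b ∈ Bset n, ∀ p, WindowRows μ ν D n (GP n b p))
    (hWQ : ∀ n : ℕ, 2 ≤ n → ∀ b ∈ Bset n, ∀ p, WindowRows μ ν D n (GQ n b p))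
    (hDP : ∀ n : ℕ, 2 ≤ n → ∀ b ∈ Bset n, ∀ p, DecayRows μ ν A δ n (GP n b p))
    (hDQ : ∀ n : ℕ, 2 ≤ n → ∀ b ∈ Bset n, ∀ p, DecayRows μ ν A δ n (GQ n b p))
    (hU : ∀ m : ℕ, 1 ≤ m →
      |F (m2Tensor (𝒯 m)) - ∑ b ∈ Bset (Lc ^ m), wt (Lc ^ m) b * fullSum (stKc μ ν N ω (GP (Lc ^ m) b) (GQ (Lc ^ m) b))| ≤ U)
    {rr γ₀ β' β₀ : ℝ} (hγ₀ : 0 < γ₀) (hrem : RemainderConst Sβ γ₀ rr) (hr : rr < B12Normalization.stepBal N Lc)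
    (hcont : BetaContH γ₀ β) (hup : BetaUpperH β' γ₀ β) (hβ' : 0 ≤ β') (hβ₀ : 0 < β₀)
    {L : ℕ} (hL2 : 2 ≤ L) (p : ℕ) {κ₀ : ℕ} (hκ : 6 ≤ κ₀) :
    EndpointExistence Cn ∧ ∃ γ₁ : ℝ, 0 < γ₁ ∧
      ∀ γ : ℝ, 0 < γ → γ ≤ min γ₀ γ₁ → ∀ Pr : B12.RunParams, (Cn Pr).flow.InInterval γ Pr.K →
        ∀ p' : ℕ, p' ≤ p → ∀ A₀ : ℝ, 0 ≤ A₀ →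
          ∃ Rj : ℕ → ℕ, (∀ j, B14.IsRj L p' ((Cn Pr).flow.g j) (Rj j)) ∧
            HorizonFacts (Cn Pr).flow β' β₀ A₀ L p' κ₀ Rj Pr.K :=
  have hR' : ∀ p ∈ (Finset.univ : Finset (BfIdx × K)), 0 ≤ A ((bfP hμν p.1).a - 2) := fun p _ => hA _
  have hS' : ∀ p ∈ (Finset.univ : Finset (BfIdx × K)), 0 ≤ A ((bfQ hμν p.1).a - 2) * 2 ^ (bfQ hμν p.1).a :=
    fun p _ => mul_nonneg (hA _) (by positivity)
  wallEND_of_slotRows_scalewise_allProfiles hgen hhalt hcur Sβ hμν hN hL hω T 𝒯 hTA hT0 hT1 F hFadd hβ htel hD hA hδ hwt0 hwt1 hc hM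
    hML hWP hWQ hDP hDQ
    (oneShotRepresentation_of_slotFullSum hμν hL hwt0 hwt1 hR' hS' hδ (hFtail_slots_avg hμν hA hDP hL)
      (hGtail_slots_avg hμν hA hδ (fun L hL2 => (hM L hL2).1) hDQ hL) hU one_pos)
    hγ₀ hrem hr hcont hup hβ' hβ₀ hL2 p hκ

end Slots

/-! ## §5 (v1.2) THE (D1-tel) TELESCOPE FORM ON THE [III] SIDE (twin of `DriftRemainder.endpointExistence_of_telescope_remainderConst`)

The carver's (D1-tel) node in END form: the partial sums of `S.β0` ARE a sequence `B (L^k)` ((T1) `hTel`) and `|B n − b·log n| ≤ A` for `n ≥ 2`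
((T2) `hB`) ⟹ `OneLoopDrift (b·log L) A S.β0` (`OneShotTelescope.oneLoopDrift_of_telescope`, kernel) ⟹ §3's socket.  Smallest displayed form of the
wall's one-loop content; (D4) is `RemainderConst S γ₀ r` with `r < b·log L` STRICTLY on the [III] side. -/

section Telescope

open Literature.MathematicalPhysics.QuantumFieldTheory.Balaban1983to89.Beta.OneShotTelescope (oneLoopDrift_of_telescope)

variable {β : HBeta}

/-- **THE (D1-tel) TELESCOPE FORM, [III] SIDE, ALL PROFILES** — twin of `DriftRemainder.endpointExistence_of_telescope_remainderConst` with the [III]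
deltas (`(hhalt)(hcur)` after `hgen`; `{… β₀}`; `hr : r < b * Real.log L` STRICT; `hβ'` behind `hup`; tail `(hβ₀){Lh}(hL2)(p){κ₀}(hκ)` — the horizon
base is named `Lh` here because `L` is the telescope base).
[cite: Balaban1987RG1, Thm 2 p.259 and Thm 3 p.264] [cite: Balaban1988Convergent, (2.5)–(2.9) pp.255–256, (2.28) p.259, (2.46) p.263] -/
theorem wallEND_of_telescope_remainderConst_allProfiles {C : B12.Construction} (hgen : ForwardGenerated C β) (hhalt : HaltsOutside C β)
    (hcur : CurriesHBeta C β) (S : B12Beta.OneLoopSplit β) {B : ℕ → ℝ} {L : ℕ} {γ₀ b A r β' β₀ : ℝ} (hγ₀ : 0 < γ₀) (hL : 2 ≤ L)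
    (hA : 0 ≤ A) (hTel : ∀ k : ℕ, ∑ j ∈ Finset.range k, S.β0 j = B (L ^ k)) (hB : ∀ n : ℕ, 2 ≤ n → |B n - b * Real.log n| ≤ A)
    (hrem : RemainderConst S γ₀ r) (hr : r < b * Real.log L) (hcont : BetaContH γ₀ β) (hup : BetaUpperH β' γ₀ β) (hβ' : 0 ≤ β')
    (hβ₀ : 0 < β₀) {Lh : ℕ} (hL2 : 2 ≤ Lh) (p : ℕ) {κ₀ : ℕ} (hκ : 6 ≤ κ₀) :
    EndpointExistence C ∧ ∃ γ₁ : ℝ, 0 < γ₁ ∧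
      ∀ γ : ℝ, 0 < γ → γ ≤ min γ₀ γ₁ → ∀ Pr : B12.RunParams, (C Pr).flow.InInterval γ Pr.K →
        ∀ p' : ℕ, p' ≤ p → ∀ A₀ : ℝ, 0 ≤ A₀ →
          ∃ Rj : ℕ → ℕ, (∀ j, B14.IsRj Lh p' ((C Pr).flow.g j) (Rj j)) ∧
            HorizonFacts (C Pr).flow β' β₀ A₀ Lh p' κ₀ Rj Pr.K :=
  wallEND_of_drift_remainderConst_allProfiles hgen hhalt hcur S hγ₀ (oneLoopDrift_of_telescope hL hA hTel hB) hrem hr hcont hup hβ'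
    hβ₀ hL2 p hκ

/-- **… AT SLOPE ≥ 0** (`r ≤ b·log L`; NO continuity): (2.6)–(2.9) for all profiles, without (2.46). [cite: Balaban1988Convergent, (2.5)–(2.9) pp.255–256] -/
theorem flowIneq_of_telescope_remainderConst_allProfiles {C : B12.Construction} (hgen : ForwardGenerated C β) (hhalt : HaltsOutside C β)
    (hcur : CurriesHBeta C β) (S : B12Beta.OneLoopSplit β) {B : ℕ → ℝ} {L : ℕ} {γ₀ b A r β' β₀ : ℝ} (hγ₀ : 0 < γ₀) (hL : 2 ≤ L)
    (hA : 0 ≤ A) (hTel : ∀ k : ℕ, ∑ j ∈ Finset.range k, S.β0 j = B (L ^ k)) (hB : ∀ n : ℕ, 2 ≤ n → |B n - b * Real.log n| ≤ A)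
    (hrem : RemainderConst S γ₀ r) (hr : r ≤ b * Real.log L) (hup : BetaUpperH β' γ₀ β) (hβ' : 0 ≤ β') (hβ₀ : 0 < β₀) {Lh : ℕ}
    (hL2 : 2 ≤ Lh) (p : ℕ) :
    ∃ γ₁ : ℝ, 0 < γ₁ ∧
      ∀ γ : ℝ, 0 < γ → γ ≤ min γ₀ γ₁ → ∀ Pr : B12.RunParams, (C Pr).flow.InInterval γ Pr.K →
        ∀ p' : ℕ, p' ≤ p → ∀ A₀ : ℝ, 0 ≤ A₀ →
          ∃ Rj : ℕ → ℕ, (∀ j, B14.IsRj Lh p' ((C Pr).flow.g j) (Rj j)) ∧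
            B14.FlowIneq26 (C Pr).flow.g β' β₀ Pr.K ∧ B14.FlowIneq27 (C Pr).flow.g β' β₀ p' Pr.K ∧
            B14.FlowIneq28 (epsK A₀ p' (C Pr).flow) (C Pr).flow.g β' β₀ Pr.K ∧
            B14FlowStep.FlowIneq29 Rj (C Pr).flow.g Lh β' β₀ Pr.K :=
  flowIneq_of_drift_remainderConst_allProfiles hgen hhalt hcur S hγ₀ (oneLoopDrift_of_telescope hL hA hTel hB) hrem hr hup hβ' hβ₀ hL2 p

end Telescope

/-! ## §6 (v1.3) THE DRIFT AND TELESCOPE SOCKETS WITH THE PRINTED-TYPE UPPER BOUND DERIVED (an4 `DriftRemainder` v1.1 §6, p186633)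

an4's §6 proves that on ANY road holding a drift `OneLoopDrift b A S.β0` and the constant-form remainder `RemainderConst S γ₀ r` the printed-type upper
bound is NOT an independent input: `betaUpperH_of_drift_remainderConst S hdrift hrem : BetaUpperH (b + 2A + r) γ₀ β` and, for the sign,
`upperConst_nonneg hγ₀ hdrift hrem (hr : r ≤ b) : 0 ≤ b + 2A + r`; its END forms `endpointExistence_of_drift_remainderConst_cont` /
`_of_telescope_remainderConst_cont` keep of the wall's row (D5) only (C) = `BetaContH γ₀ β` (journal NOTE an4-g13 → strat-b14, 2026-08-19T10:36:27Z:
«consumers need NOT re-version: their `hup`/`hβ'` binders stay correct, merely instantiable»).  Here are the [III] twins: §3's and §5's sockets with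
`hup`/`hβ'` DISCHARGED by those two lemmas — so the printed-type constant β′ of (2.6)–(2.9) ([Balaban1988Convergent] p. 255 «β′» in `HorizonFacts … β′ β₀ …`)
is COMPUTED as `b + 2A + r` (resp. `b·log L + 2A + r`) from the drift data, and the (D5)-free consumers ((2.6)–(2.9) without (2.46); the T⁴ cell's
C19/C20) need NOTHING beyond the drift, (D4) with `r ≤ b`, `0 < γ₀` and the structural / run-side data.  ONE application each; [folklore]; nothing of
the series is discharged; NOT Theorem 2, NOT the wall, NOT continuum, NOT Clay. -/

section DerivedUpper

open Literature.MathematicalPhysics.QuantumFieldTheory.Balaban1983to89.Beta.DriftRemainder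
  (betaUpperH_of_drift_remainderConst upperConst_nonneg)
open Literature.MathematicalPhysics.QuantumFieldTheory.Balaban1983to89.Beta.OneShotTelescope (oneLoopDrift_of_telescope)

variable {β : HBeta}

/-- **THE DRIFT × CONSTANT-REMAINDER SOCKET WITH β′ DERIVED, [III] SIDE, ALL PROFILES** — twin of an4's
`DriftRemainder.endpointExistence_of_drift_remainderConst_cont`: `OneLoopDrift b A S.β0`, `RemainderConst S γ₀ r` with `r < b` STRICTLY, (C) and the [III]
run-side data ⟹ `EndpointExistence C ∧ ∃ γ₁ > 0, ∀ γ ≤ min γ₀ γ₁, ∀ runs in ]0,γ], ∀ p′ ≤ p, ∀ A₀ ≥ 0: sizes ∧ HorizonFacts` with the printed-type constant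
`β′ := b + 2A + r` (§3 fed `betaUpperH_of_drift_remainderConst` and `upperConst_nonneg`).  Of (D5) only (C) remains a binder.
[cite: Balaban1987RG1, Thm 2 p.259 and Thm 3 p.264] [cite: Balaban1988Convergent, (2.5)–(2.9) pp.255–256, (2.28) p.259, (2.46) p.263] -/
theorem wallEND_of_drift_remainderConst_cont_allProfiles {C : B12.Construction} (hgen : ForwardGenerated C β) (hhalt : HaltsOutside C β)
    (hcur : CurriesHBeta C β) (S : B12Beta.OneLoopSplit β) {γ₀ b A r β₀ : ℝ} (hγ₀ : 0 < γ₀) (hdrift : OneLoopDrift b A S.β0)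
    (hrem : RemainderConst S γ₀ r) (hr : r < b) (hcont : BetaContH γ₀ β) (hβ₀ : 0 < β₀) {L : ℕ} (hL2 : 2 ≤ L) (p : ℕ) {κ₀ : ℕ}
    (hκ : 6 ≤ κ₀) :
    EndpointExistence C ∧ ∃ γ₁ : ℝ, 0 < γ₁ ∧
      ∀ γ : ℝ, 0 < γ → γ ≤ min γ₀ γ₁ → ∀ Pr : B12.RunParams, (C Pr).flow.InInterval γ Pr.K →
        ∀ p' : ℕ, p' ≤ p → ∀ A₀ : ℝ, 0 ≤ A₀ →
          ∃ Rj : ℕ → ℕ, (∀ j, B14.IsRj L p' ((C Pr).flow.g j) (Rj j)) ∧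
            HorizonFacts (C Pr).flow (b + 2 * A + r) β₀ A₀ L p' κ₀ Rj Pr.K :=
  wallEND_of_drift_remainderConst_allProfiles hgen hhalt hcur S hγ₀ hdrift hrem hr hcont (betaUpperH_of_drift_remainderConst S hdrift hrem)
    (upperConst_nonneg hγ₀ hdrift hrem hr.le) hβ₀ hL2 p hκ

/-- **… AT SLOPE ≥ 0, NO (C), NO (U): (2.6)–(2.9) FOR ALL PROFILES with β′ := b + 2A + r** from the drift, (D4) with `r ≤ b`, `0 < γ₀` and the structural /
run-side data ONLY. [cite: Balaban1988Convergent, (2.5)–(2.9) pp.255–256] -/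
theorem flowIneq_of_drift_remainderConst_cont_allProfiles {C : B12.Construction} (hgen : ForwardGenerated C β) (hhalt : HaltsOutside C β)
    (hcur : CurriesHBeta C β) (S : B12Beta.OneLoopSplit β) {γ₀ b A r β₀ : ℝ} (hγ₀ : 0 < γ₀) (hdrift : OneLoopDrift b A S.β0)
    (hrem : RemainderConst S γ₀ r) (hr : r ≤ b) (hβ₀ : 0 < β₀) {L : ℕ} (hL2 : 2 ≤ L) (p : ℕ) :
    ∃ γ₁ : ℝ, 0 < γ₁ ∧
      ∀ γ : ℝ, 0 < γ → γ ≤ min γ₀ γ₁ → ∀ Pr : B12.RunParams, (C Pr).flow.InInterval γ Pr.K →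
        ∀ p' : ℕ, p' ≤ p → ∀ A₀ : ℝ, 0 ≤ A₀ →
          ∃ Rj : ℕ → ℕ, (∀ j, B14.IsRj L p' ((C Pr).flow.g j) (Rj j)) ∧
            B14.FlowIneq26 (C Pr).flow.g (b + 2 * A + r) β₀ Pr.K ∧ B14.FlowIneq27 (C Pr).flow.g (b + 2 * A + r) β₀ p' Pr.K ∧
            B14.FlowIneq28 (epsK A₀ p' (C Pr).flow) (C Pr).flow.g (b + 2 * A + r) β₀ Pr.K ∧
            B14FlowStep.FlowIneq29 Rj (C Pr).flow.g L (b + 2 * A + r) β₀ Pr.K :=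
  flowIneq_of_drift_remainderConst_allProfiles hgen hhalt hcur S hγ₀ hdrift hrem hr (betaUpperH_of_drift_remainderConst S hdrift hrem)
    (upperConst_nonneg hγ₀ hdrift hrem hr) hβ₀ hL2 p

/-- **… AT SLOPE ≥ 0, NO (C), NO (U): THE T⁴ CELL's FLOW-FACT BINDERS (C19/C20) with β′ := b + 2A + r.** [cite: Balaban1988Convergent, (2.5)–(2.9) pp.255–256] -/
theorem t4FlowInputs_of_drift_remainderConst_cont {C : B12.Construction} (hgen : ForwardGenerated C β) (hhalt : HaltsOutside C β)
    (hcur : CurriesHBeta C β) (S : B12Beta.OneLoopSplit β) {γ₀ b A r β₀ : ℝ} (hγ₀ : 0 < γ₀) (hdrift : OneLoopDrift b A S.β0)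
    (hrem : RemainderConst S γ₀ r) (hr : r ≤ b) (hβ₀ : 0 < β₀) {L : ℕ} (hL2 : 2 ≤ L) {p₀ r' : ℕ} (hr' : r' ≤ p₀) :
    ∃ γ₁ : ℝ, 0 < γ₁ ∧ ∀ γ : ℝ, 0 < γ → γ ≤ min γ₀ γ₁ → ∀ Pr : B12.RunParams, (C Pr).flow.InInterval γ Pr.K →
      B14.FlowIneq27 (C Pr).flow.g (b + 2 * A + r) β₀ p₀ Pr.K ∧
      (∀ j, j ≤ Pr.K → 1 ≤ Real.log (((C Pr).flow.g j) ^ 2)⁻¹) ∧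
      ∃ Rj : ℕ → ℕ, (∀ j, B14.IsRj L r' ((C Pr).flow.g j) (Rj j)) ∧ B14FlowStep.FlowIneq29 Rj (C Pr).flow.g L (b + 2 * A + r) β₀ Pr.K :=
  t4FlowInputs_of_drift_remainderConst hgen hhalt hcur S hγ₀ hdrift hrem hr (betaUpperH_of_drift_remainderConst S hdrift hrem)
    (upperConst_nonneg hγ₀ hdrift hrem hr) hβ₀ hL2 hr'

/-- **THE (D1-tel) TELESCOPE FORM WITH β′ DERIVED, [III] SIDE, ALL PROFILES** — twin of an4's `DriftRemainder.endpointExistence_of_telescope_remainderConst_cont`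
((T1) `hTel`, (T2) `hB`, `RemainderConst` with `r < b·log L` STRICTLY, (C), the [III] run-side data; β′ := b·log L + 2A + r; horizon base `Lh`).
[cite: Balaban1987RG1, Thm 2 p.259 and Thm 3 p.264] [cite: Balaban1988Convergent, (2.5)–(2.9) pp.255–256, (2.28) p.259, (2.46) p.263] -/
theorem wallEND_of_telescope_remainderConst_cont_allProfiles {C : B12.Construction} (hgen : ForwardGenerated C β) (hhalt : HaltsOutside C β)
    (hcur : CurriesHBeta C β) (S : B12Beta.OneLoopSplit β) {B : ℕ → ℝ} {L : ℕ} {γ₀ b A r β₀ : ℝ} (hγ₀ : 0 < γ₀) (hL : 2 ≤ L)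
    (hA : 0 ≤ A) (hTel : ∀ k : ℕ, ∑ j ∈ Finset.range k, S.β0 j = B (L ^ k)) (hB : ∀ n : ℕ, 2 ≤ n → |B n - b * Real.log n| ≤ A)
    (hrem : RemainderConst S γ₀ r) (hr : r < b * Real.log L) (hcont : BetaContH γ₀ β) (hβ₀ : 0 < β₀) {Lh : ℕ} (hL2 : 2 ≤ Lh) (p : ℕ)
    {κ₀ : ℕ} (hκ : 6 ≤ κ₀) :
    EndpointExistence C ∧ ∃ γ₁ : ℝ, 0 < γ₁ ∧
      ∀ γ : ℝ, 0 < γ → γ ≤ min γ₀ γ₁ → ∀ Pr : B12.RunParams, (C Pr).flow.InInterval γ Pr.K →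
        ∀ p' : ℕ, p' ≤ p → ∀ A₀ : ℝ, 0 ≤ A₀ →
          ∃ Rj : ℕ → ℕ, (∀ j, B14.IsRj Lh p' ((C Pr).flow.g j) (Rj j)) ∧
            HorizonFacts (C Pr).flow (b * Real.log L + 2 * A + r) β₀ A₀ Lh p' κ₀ Rj Pr.K :=
  wallEND_of_drift_remainderConst_cont_allProfiles hgen hhalt hcur S hγ₀ (oneLoopDrift_of_telescope hL hA hTel hB) hrem hr hcont hβ₀ hL2 p hκ

/-- **… AT SLOPE ≥ 0, NO (C), NO (U)** (`r ≤ b·log L`): (2.6)–(2.9) for all profiles with β′ := b·log L + 2A + r. [cite: Balaban1988Convergent, (2.5)–(2.9) pp.255–256] -/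
theorem flowIneq_of_telescope_remainderConst_cont_allProfiles {C : B12.Construction} (hgen : ForwardGenerated C β) (hhalt : HaltsOutside C β)
    (hcur : CurriesHBeta C β) (S : B12Beta.OneLoopSplit β) {B : ℕ → ℝ} {L : ℕ} {γ₀ b A r β₀ : ℝ} (hγ₀ : 0 < γ₀) (hL : 2 ≤ L)
    (hA : 0 ≤ A) (hTel : ∀ k : ℕ, ∑ j ∈ Finset.range k, S.β0 j = B (L ^ k)) (hB : ∀ n : ℕ, 2 ≤ n → |B n - b * Real.log n| ≤ A)
    (hrem : RemainderConst S γ₀ r) (hr : r ≤ b * Real.log L) (hβ₀ : 0 < β₀) {Lh : ℕ} (hL2 : 2 ≤ Lh) (p : ℕ) :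
    ∃ γ₁ : ℝ, 0 < γ₁ ∧
      ∀ γ : ℝ, 0 < γ → γ ≤ min γ₀ γ₁ → ∀ Pr : B12.RunParams, (C Pr).flow.InInterval γ Pr.K →
        ∀ p' : ℕ, p' ≤ p → ∀ A₀ : ℝ, 0 ≤ A₀ →
          ∃ Rj : ℕ → ℕ, (∀ j, B14.IsRj Lh p' ((C Pr).flow.g j) (Rj j)) ∧
            B14.FlowIneq26 (C Pr).flow.g (b * Real.log L + 2 * A + r) β₀ Pr.K ∧ B14.FlowIneq27 (C Pr).flow.g (b * Real.log L + 2 * A + r) β₀ p' Pr.K ∧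
            B14.FlowIneq28 (epsK A₀ p' (C Pr).flow) (C Pr).flow.g (b * Real.log L + 2 * A + r) β₀ Pr.K ∧
            B14FlowStep.FlowIneq29 Rj (C Pr).flow.g Lh (b * Real.log L + 2 * A + r) β₀ Pr.K :=
  flowIneq_of_drift_remainderConst_cont_allProfiles hgen hhalt hcur S hγ₀ (oneLoopDrift_of_telescope hL hA hTel hB) hrem hr hβ₀ hL2 p

end DerivedUpper

end Literature.MathematicalPhysics.QuantumFieldTheory.Balaban1983to89.Beta.AveragedAFCarrierScalewise
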